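import Mathlib.Analysis.InnerProductSpace.PiL2
import Mathlib.Analysis.InnerProductSpace.LinearMap
import Mathlib.Analysis.SpecialFunctions.Trigonometric.Inverse
import Mathlib.LinearAlgebra.FiniteDimensional.Lemmas
import Mathlib.LinearAlgebra.Basis.Bilinear
import Literature.Geometry.DiscreteGeometry.FejesTothKissingTwelve
import HarnessLib

/-!
# Rigidity of the FCC and HCP kissing configurations (Hales 2012, Lemma 10) — proved

Topic `Literature/Geometry/DiscreteGeometry`; provefact item for `Hales2012_kissingTwelve`
(sibling of `FejesTothKissingTwelve.lean`, which it imports). That file vendors Hales's proof of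
Theorem 1 as: Lemma 1 (`flyspeck_L12`, computer) ⟹ Lemma 2 (proved) ⟹ shells lie in `𝒱`
(proved) ⟹ [Theorem 3 + Lemma 9 (computer): the contact graph is FCC or HCP —
`Hales2012_contactGraphFccOrHcp`] ⟹ [Lemma 10 (rigidity): congruent to the FCC or HCP
configuration — folded into the named fact `Hales2012_kissingConfigCongruent`].  Here we PROVE
Lemma 10, so that the only unproved inputs to Theorem 1 are the two computer calculations:

* `kissingConfigCongruent_of_contactGraphFccOrHcp :
    Hales2012_contactGraphFccOrHcp → Hales2012_kissingConfigCongruent` (and the elementary converse,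
  `kissingConfigCongruent_iff_contactGraphFccOrHcp`);
* `hales2012_kissingTwelve_of_L12_of_contactGraph :
    flyspeck_L12 → Hales2012_contactGraphFccOrHcp → Hales2012_kissingTwelve`.

## Source

Hales, arXiv:1209.6043, p. 14: "**Lemma 10.** Let `V ∈ 𝒱` be a packing such that
`hyp(V, E₂(V))` is isomorphic to the FCC or HCP contact hypermap. Then `V` is congruent to the FCC
or HCP configuration in `S²(2)`. *Proof.* Every face of the hypermap of `(V, E₂(V))` is a triangle
or quadrilateral. The eight triangles in the FCC or HCP contact hypermap determine eight
equilateral triangles in `V` of edge length `2`. The eight triangles rigidly determine `V` up to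
congruence."  We prove the graph-level statement (hypothesis: a graph isomorphism
`contactGraph S ≃g contactGraph (2·P)`, weaker than a hypermap isomorphism), for `S ∈ 𝒱`
(`IsKissingConfig S`: twelve points of `S²(2)`, pairwise distances `2` or `≥ 2h₀ = 2.52`).

## The proof formalised here (elementary; the separation property of `𝒱` is used throughout)

Write `σ = 4 − 2h₀² = 0.8248 < 8/9`: contacts have `⟪x, y⟫ = 2`, separated pairs `⟪x, y⟫ ≤ σ`.
1. *Tangent coordinates* (Part C). At a vertex `v` with contact triangles `vab`, `vcd`
   (type `(3,4,3,4)`: all FCC vertices, the six cap vertices of HCP) put `e₁ = a − v/2`,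
   `e₂ = 3b − a − v` (an orthogonal frame of `v^⊥`, by three-dimensionality, Part B) and
   `X = ⟪c − v/2, e₁⟫`, `Y = ⟪c − v/2, e₂⟫`; then `8X² + Y² = 72`, and the same for `d`, with
   `8XX' + YY' = 24`; hence `XY' − YX' = ±24`.  The sign `−24` would force
   `⟪a, d⟫ ≤ 1 − 2√2` for the square diagonal `a, d`, contradicting the *rhombus lemma*
   (Part B: for a contact square `vawc`, `(4 + ⟪a,c⟫)(v + w) = 4(a + c)`, so
   `(4 + ⟪a,c⟫)(4 + ⟪v,w⟫) = 16` and `⟪a,c⟫ ≥ −1`).  The sign `+24` gives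
   `⟪b,c⟫ = 1 + (X+Y)/3`, `⟪a,d⟫ = 1 + (X−Y)/3` and the *vertex identity*
   `θ⟪b,c⟫ + θ⟪a,d⟫ = 2 arccos(−1/3)` for `θ(s) = arccos((s−1)/3)` (Part A: the two square angles
   at `v` fill the complement of the two triangle angles `arccos(1/3)`).  Vertices of type
   `(3,3,4,4)` (the hexagonal layer of HCP) are similar and give in addition `3u + 3l = 2h + 2e`.
2. *Rhombus inequality* (Part A): for a contact square, `θ(s) + θ(t) ≤ 2 arccos(−1/3)` with
   equality iff `s = t = 0` — a polynomial identity
   `81[(1−p²)(1−q²) − (pq + 7/9)²] = −(s+t)(9(s+t) − 16)` plus monotonicity of `cos` on `[π, 2π]`.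
3. *Counting* (Part F): summing the twelve vertex identities gives `Σ_squares 2(θ(s) + θ(t)) =
   24 arccos(−1/3)`, so all six squares are extremal: planar squares (`v + w = a + c`,
   diagonals perpendicular); then the far pairs at each vertex satisfy `a + c = v`, and every
   point is an explicit `ℤ[1/3]`-combination of a base contact triangle, exactly as in the model;
   a base triangle has Gram matrix `[[4,2,2],[2,4,2],[2,2,4]]`, whence a linear isometry (Part B).
4. Part G transports this through the enumerations `fccTab`, `hcpTab` of `fccInt`, `hcpInt` and
   the graph isomorphism.  The combinatorial bookkeeping of Part F (which indices form the
   squares and the vertex stars of the cuboctahedron and of the anticuboctahedron) is discharged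
   by `decide` on the integer tables.

## Contents (namespace `Literature.DiscreteGeom`)

* Part A: `tangentAngle`, `arccos_add_arccos_eq_of_ellipse`, `tangentAngle_add_le`.
* Part B: `eq_zero_of_inner_linearIndependent_fin_three`, `eq_expansion_of_inner_eq_zero`,
  `exists_linearIsometry_of_inner_eq`, `rhombus_smul_add_eq`.
* Part C: `vertex_tangent_coords` (type `(3,4,3,4)`), `vertex_tangent_coords'` (type `(3,3,4,4)`).
* Part D: `IsRealization adj σ x` and its `square`/`vertex`/`vertex'` lemmas.
* Part E: `fccTab`, `hcpTab`, `fccAdj`, `hcpAdj`, `refPt`, `fccRef`, `hcpRef`; non-vacuity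
  `isRealization_fccRef`, `isRealization_hcpRef` (the models realize their own patterns).
* Part F: `fcc_rigid`, `hcp_rigid`.
* Part G: `isArrangedIn_fcc_of_contactGraph_iso`, `isArrangedIn_hcp_of_contactGraph_iso`
  (Lemma 10), `kissingConfigCongruent_of_contactGraphFccOrHcp`,
  `kissingConfigCongruent_iff_contactGraphFccOrHcp`,
  `hales2012_kissingTwelve_of_L12_of_contactGraph`, `fejesTothKissingTwelve_of_L12_of_contactGraph`.

## References

* T. C. Hales, *A proof of Fejes Tóth's conjecture on sphere packings with kissing number twelve*,
  arXiv:1209.6043 (2012), Lemma 10 and proof of Theorem 1, p. 14 (`Hales2012`).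
* T. C. Hales, *Dense Sphere Packings. A Blueprint for Formal Proofs*, LMS Lecture Note Ser. 400,
  CUP (2012), §1.3, Fig. 1.11 (`HalesDSP2012`) — the two patterns.
-/

noncomputable section

namespace Literature.Geometry.DiscreteGeometry

open Real

/-! ### Part A. Two facts about `arccos`: the vertex identity and the rhombus inequality -/

/-- The "tangent angle" attached to the inner product `s = ⟪x, y⟫` of two neighbours `x, y` of a
point `v` on `S²(2)` (`‖v‖ = ‖x‖ = ‖y‖ = 2`, `⟪v, x⟫ = ⟪v, y⟫ = 2`): the angle at `v` between the
tangent vectors `x − v/2` and `y − v/2` is `arccos ((s − 1)/3)`. [folklore] -/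
def tangentAngle (s : ℝ) : ℝ := arccos ((s - 1) / 3)

/-- The tangent angle of a perpendicular pair is `arccos (−1/3) ≈ 109.47°`. [folklore] -/
theorem tangentAngle_zero : tangentAngle 0 = arccos (-1 / 3) := by
  rw [tangentAngle]; norm_num

/-- `cos (2 arccos (−1/3)) = −7/9`. [folklore] -/
theorem cos_two_mul_arccos_neg_third : cos (2 * arccos (-1 / 3)) = -7 / 9 := by
  rw [cos_two_mul, cos_arccos (by norm_num) (by norm_num)]
  norm_num

/-- `cos (arccos p + arccos q) = pq − √(1 − p²) √(1 − q²)`. [folklore] -/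
theorem cos_arccos_add_arccos {p q : ℝ} (hp₁ : -1 ≤ p) (hp₂ : p ≤ 1) (hq₁ : -1 ≤ q) (hq₂ : q ≤ 1) :
    cos (arccos p + arccos q) = p * q - √(1 - p ^ 2) * √(1 - q ^ 2) := by
  rw [cos_add, cos_arccos hp₁ hp₂, cos_arccos hq₁ hq₂, sin_arccos, sin_arccos]

/-- On `[π, 2π]` the cosine is increasing: `cos x ≤ cos y → x ≤ y`. [folklore] -/
theorem le_of_cos_le_cos_of_pi_le {x y : ℝ} (_hx₁ : π ≤ x) (hx₂ : x ≤ 2 * π) (hy₁ : π ≤ y)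
    (_hy₂ : y ≤ 2 * π) (h : cos x ≤ cos y) : x ≤ y := by
  by_contra hlt
  push Not at hlt
  have h1 : 2 * π - x ∈ Set.Icc 0 π := ⟨by linarith, by linarith⟩
  have h2 : 2 * π - y ∈ Set.Icc 0 π := ⟨by linarith, by linarith⟩
  have := strictAntiOn_cos h1 h2 (by linarith)
  rw [cos_two_pi_sub, cos_two_pi_sub] at this
  linarith

/-- On `[π, 2π]` the cosine is injective. [folklore] -/
theorem eq_of_cos_eq_cos_of_pi_le {x y : ℝ} (hx₁ : π ≤ x) (hx₂ : x ≤ 2 * π) (hy₁ : π ≤ y)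
    (hy₂ : y ≤ 2 * π) (h : cos x = cos y) : x = y :=
  le_antisymm (le_of_cos_le_cos_of_pi_le hx₁ hx₂ hy₁ hy₂ h.le)
    (le_of_cos_le_cos_of_pi_le hy₁ hy₂ hx₁ hx₂ h.ge)

/-- `arccos p ∈ [π/2, π]` for `p ≤ 0`. [folklore] -/
theorem pi_div_two_le_arccos_of_nonpos {p : ℝ} (hp : p ≤ 0) : π / 2 ≤ arccos p :=
  not_lt.1 fun h => (not_lt.2 hp) (arccos_lt_pi_div_two.1 h)

/-- **The vertex identity.** If `8X² + Y² = 72`, `X + Y ≤ 0` and `X − Y ≤ 0`, then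
`arccos ((X + Y)/9) + arccos ((X − Y)/9) = 2 arccos (−1/3)`: writing `X = 3 cos γ`,
`Y = 6√2 sin γ` and `cos A = 1/3`, the two angles are `γ − A ∈ [π/2, π]` and
`2π − γ − A ∈ [π/2, π]`, which sum to `2π − 2A`. [folklore] -/
theorem arccos_add_arccos_eq_of_ellipse {X Y : ℝ} (h : 8 * X ^ 2 + Y ^ 2 = 72) (h₁ : X + Y ≤ 0)
    (h₂ : X - Y ≤ 0) : arccos ((X + Y) / 9) + arccos ((X - Y) / 9) = 2 * arccos (-1 / 3) := by
  set p := (X + Y) / 9 with hp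
  set q := (X - Y) / 9 with hq
  have hp0 : p ≤ 0 := by rw [hp]; linarith
  have hq0 : q ≤ 0 := by rw [hq]; linarith
  have hp1 : -1 ≤ p := by
    rw [hp]
    have : (X + Y) ^ 2 ≤ 81 := by nlinarith [sq_nonneg (8 * X - Y)]
    nlinarith
  have hq1 : -1 ≤ q := by
    rw [hq]
    have : (X - Y) ^ 2 ≤ 81 := by nlinarith [sq_nonneg (8 * X + Y)]
    nlinarith
  have hA : 0 ≤ Y - 8 * X := by linarith
  have hB : 0 ≤ -(Y + 8 * X) := by linarith
  have e1 : 1 - p ^ 2 = ((Y - 8 * X) ^ 2) / 648 := by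
    rw [hp]; linear_combination (-1/72:ℝ) * h
  have e2 : 1 - q ^ 2 = ((Y + 8 * X) ^ 2) / 648 := by
    rw [hq]; linear_combination (-1/72:ℝ) * h
  have hcos : cos (arccos p + arccos q) = -7 / 9 := by
    rw [cos_arccos_add_arccos hp1 (by linarith) hq1 (by linarith), e1, e2,
      show (Y - 8 * X) ^ 2 / 648 = ((Y - 8 * X) / √648) ^ 2 by
        rw [div_pow, sq_sqrt (by norm_num)],
      show (Y + 8 * X) ^ 2 / 648 = (-(Y + 8 * X) / √648) ^ 2 by
        rw [div_pow, neg_sq, sq_sqrt (by norm_num)],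
      sqrt_sq (div_nonneg hA (sqrt_nonneg _)), sqrt_sq (div_nonneg hB (sqrt_nonneg _))]
    simp only [div_mul_div_comm]
    rw [mul_self_sqrt (by norm_num : (0:ℝ) ≤ 648), hp, hq]
    linear_combination (-7/648:ℝ) * h
  have hπp := pi_div_two_le_arccos_of_nonpos hp0
  have hπq := pi_div_two_le_arccos_of_nonpos hq0
  have hπ0 : π / 2 ≤ arccos (-1 / 3) := pi_div_two_le_arccos_of_nonpos (by norm_num)
  exact eq_of_cos_eq_cos_of_pi_le (by linarith) (by linarith [arccos_le_pi p, arccos_le_pi q])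
    (by linarith) (by linarith [arccos_le_pi (-1 / 3 : ℝ)])
    (by rw [hcos, cos_two_mul_arccos_neg_third])

/-- **The rhombus inequality.** If `(4 + s)(4 + t) = 16` with `−4 ≤ s` and `s, t ≤ σ < 8/9`, then
`tangentAngle s + tangentAngle t ≤ 2 · tangentAngle 0`, with equality iff `s = t = 0`: a spherical
rhombus on `S²(2)` with side (chord) `2` has angle sum at most that of the square one (diagonals
`2√2`, i.e. `s = t = 0`), which is the unique maximiser. Polynomial identity behind it:
`81[(1 − p²)(1 − q²) − (pq + 7/9)²] = −(s + t)(9(s + t) − 16)` for `p = (s−1)/3`, `q = (t−1)/3`,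
`st = −4(s + t)`. [folklore] -/
theorem tangentAngle_add_le {s t σ : ℝ} (hσ : σ < 8 / 9) (hs : s ≤ σ) (ht : t ≤ σ) (hs4 : -4 ≤ s)
    (h : (4 + s) * (4 + t) = 16) :
    tangentAngle s + tangentAngle t ≤ 2 * tangentAngle 0 ∧
      (tangentAngle s + tangentAngle t = 2 * tangentAngle 0 → s = 0 ∧ t = 0) := by
  have hs' : 0 < 4 + s := by
    rcases (show (0:ℝ) ≤ 4 + s by linarith).eq_or_lt with h0 | h0
    · rw [← h0, zero_mul] at h; norm_num at h
    · exact h0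
  have ht' : 0 < 4 + t := by
    by_contra hle; push Not at hle
    nlinarith
  have hs8 : -0.8 < s := by nlinarith
  have ht8 : -0.8 < t := by nlinarith
  have hst : s * t = -4 * (s + t) := by linarith
  have hsum0 : 0 ≤ s + t := by nlinarith [sq_nonneg (s - t)]
  have hsum1 : 9 * (s + t) - 16 < 0 := by linarith
  set p := (s - 1) / 3 with hp
  set q := (t - 1) / 3 with hq
  have hp0 : p ≤ 0 := by rw [hp]; linarith
  have hq0 : q ≤ 0 := by rw [hq]; linarith
  have hp1 : -1 ≤ p := by rw [hp]; linarith
  have hq1 : -1 ≤ q := by rw [hq]; linarith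
  have key : (1 - p ^ 2) * (1 - q ^ 2) - (p * q + 7 / 9) ^ 2 =
      -(s + t) * (9 * (s + t) - 16) / 81 := by
    rw [hp, hq]; linear_combination (4/81:ℝ) * hst
  have hnn : 0 ≤ (1 - p ^ 2) * (1 - q ^ 2) := mul_nonneg (by nlinarith) (by nlinarith)
  have hcos : cos (tangentAngle s + tangentAngle t) = p * q - √((1 - p ^ 2) * (1 - q ^ 2)) := by
    rw [tangentAngle, tangentAngle, ← hp, ← hq, cos_arccos_add_arccos hp1 (by linarith) hq1
      (by linarith), sqrt_mul (by nlinarith)]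
  have hπp : π / 2 ≤ tangentAngle s := pi_div_two_le_arccos_of_nonpos hp0
  have hπq : π / 2 ≤ tangentAngle t := pi_div_two_le_arccos_of_nonpos hq0
  have hπs : tangentAngle s ≤ π := arccos_le_pi _
  have hπt : tangentAngle t ≤ π := arccos_le_pi _
  have hπ0 : π / 2 ≤ tangentAngle 0 := by
    rw [tangentAngle_zero]; exact pi_div_two_le_arccos_of_nonpos (by norm_num)
  have hπ0' : tangentAngle 0 ≤ π := arccos_le_pi _
  have hcos0 : cos (2 * tangentAngle 0) = -7 / 9 := by
    rw [tangentAngle_zero, cos_two_mul_arccos_neg_third]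
  refine ⟨?_, ?_⟩
  · refine le_of_cos_le_cos_of_pi_le (by linarith) (by linarith) (by linarith) (by linarith) ?_
    rw [hcos, hcos0]
    have : p * q + 7 / 9 ≤ √((1 - p ^ 2) * (1 - q ^ 2)) := by
      rcases le_or_gt (p * q + 7 / 9) 0 with hle | hlt
      · exact hle.trans (sqrt_nonneg _)
      · rw [le_sqrt hlt.le hnn]
        have : 0 ≤ -(s + t) * (9 * (s + t) - 16) / 81 := by
          apply div_nonneg _ (by norm_num)
          nlinarith
        linarith
    linarith
  · intro heq
    have hc : p * q - √((1 - p ^ 2) * (1 - q ^ 2)) = -7 / 9 := by rw [← hcos, heq, hcos0]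
    have hsq : √((1 - p ^ 2) * (1 - q ^ 2)) = p * q + 7 / 9 := by linarith
    have h2 : (1 - p ^ 2) * (1 - q ^ 2) = (p * q + 7 / 9) ^ 2 := by
      rw [← hsq, sq_sqrt hnn]
    have h3 : -(s + t) * (9 * (s + t) - 16) / 81 = 0 := by rw [← key, h2, sub_self]
    have h4 : s + t = 0 := by
      rcases mul_eq_zero.1 (show -(s + t) * (9 * (s + t) - 16) = 0 by linarith) with h5 | h5
      · linarith
      · exact absurd h5 hsum1.ne
    have h5 : s * t = 0 := by rw [hst, h4, mul_zero]
    rcases mul_eq_zero.1 h5 with h6 | h6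
    · exact ⟨h6, by linarith⟩
    · exact ⟨by linarith, h6⟩

/-! ### Part B. Three-dimensional linear algebra -/

open RealInnerProductSpace

/-- Euclidean `3`-space. -/
local notation "E3" => EuclideanSpace ℝ (Fin 3)

/-- A vector orthogonal to three linearly independent vectors of `ℝ³` vanishes. [folklore] -/
theorem eq_zero_of_inner_linearIndependent_fin_three {u : Fin 3 → E3} (hu : LinearIndependent ℝ u)
    {z : E3} (hz : ∀ i, ⟪z, u i⟫ = 0) : z = 0 := by
  have hspan := hu.span_eq_top_of_card_eq_finrank (by simp)
  have hz' : z ∈ Submodule.span ℝ (Set.range u) := by rw [hspan]; trivial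
  obtain ⟨c, hc⟩ := (Submodule.mem_span_range_iff_exists_fun ℝ).1 hz'
  have h0 : ⟪z, z⟫ = 0 := by
    calc ⟪z, z⟫ = ⟪z, ∑ i, c i • u i⟫ := by rw [hc]
      _ = ∑ i, c i * ⟪z, u i⟫ := by simp [inner_sum, real_inner_smul_right]
      _ = 0 := by simp [hz]
  exact inner_self_eq_zero.1 h0

/-- Three pairwise orthogonal nonzero vectors of `ℝ³` are linearly independent. [folklore] -/
theorem linearIndependent_of_orthogonal_fin_three {v e₁ e₂ : E3} (hv : v ≠ 0) (h₁ : e₁ ≠ 0)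
    (h₂ : e₂ ≠ 0) (o₁ : ⟪v, e₁⟫ = 0) (o₂ : ⟪v, e₂⟫ = 0) (o₁₂ : ⟪e₁, e₂⟫ = 0) :
    LinearIndependent ℝ ![v, e₁, e₂] := by
  refine linearIndependent_of_ne_zero_of_inner_eq_zero ?_ ?_
  · intro i
    fin_cases i <;> simpa
  · intro i j hij
    fin_cases i <;> fin_cases j <;>
      simp_all [real_inner_comm e₁ v, real_inner_comm e₂ v, real_inner_comm e₂ e₁]

/-- **Expansion in the tangent plane.** If `v, e₁, e₂` are pairwise orthogonal and nonzero in
`ℝ³`, every `u ⊥ v` is `(⟪u, e₁⟫/⟪e₁, e₁⟫) e₁ + (⟪u, e₂⟫/⟪e₂, e₂⟫) e₂`. [folklore] -/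
theorem eq_expansion_of_inner_eq_zero {v e₁ e₂ : E3} (hv : v ≠ 0) (h₁ : e₁ ≠ 0) (h₂ : e₂ ≠ 0)
    (o₁ : ⟪v, e₁⟫ = 0) (o₂ : ⟪v, e₂⟫ = 0) (o₁₂ : ⟪e₁, e₂⟫ = 0) {u : E3} (hu : ⟪u, v⟫ = 0) :
    u = (⟪u, e₁⟫ / ⟪e₁, e₁⟫) • e₁ + (⟪u, e₂⟫ / ⟪e₂, e₂⟫) • e₂ := by
  have hli := linearIndependent_of_orthogonal_fin_three hv h₁ h₂ o₁ o₂ o₁₂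
  have h11 : ⟪e₁, e₁⟫ ≠ 0 := fun h => h₁ (inner_self_eq_zero.1 h)
  have h22 : ⟪e₂, e₂⟫ ≠ 0 := fun h => h₂ (inner_self_eq_zero.1 h)
  rw [← sub_eq_zero]
  refine eq_zero_of_inner_linearIndependent_fin_three hli fun i => ?_
  fin_cases i
  · simp [inner_sub_left, inner_add_left, real_inner_smul_left, hu, real_inner_comm v e₁,
      real_inner_comm v e₂, o₁, o₂]
  · simp only [Fin.mk_one, Matrix.cons_val_one, Matrix.cons_val_zero, inner_sub_left,
      inner_add_left, real_inner_smul_left, real_inner_comm e₁ e₂, o₁₂, mul_zero, add_zero,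
      div_mul_cancel₀ _ h11, sub_self]
  · simp only [Fin.reduceFinMk, Matrix.cons_val, inner_sub_left, inner_add_left,
      real_inner_smul_left, o₁₂, mul_zero, zero_add, div_mul_cancel₀ _ h22, sub_self]

/-- Hence the inner product of two tangent vectors in tangent coordinates:
`⟪u, u'⟫ = ⟪u, e₁⟫⟪u', e₁⟫/⟪e₁, e₁⟫ + ⟪u, e₂⟫⟪u', e₂⟫/⟪e₂, e₂⟫`. [folklore] -/
theorem inner_eq_of_inner_eq_zero {v e₁ e₂ : E3} (hv : v ≠ 0) (h₁ : e₁ ≠ 0) (h₂ : e₂ ≠ 0)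
    (o₁ : ⟪v, e₁⟫ = 0) (o₂ : ⟪v, e₂⟫ = 0) (o₁₂ : ⟪e₁, e₂⟫ = 0) {u : E3} (u' : E3)
    (hu : ⟪u, v⟫ = 0) :
    ⟪u, u'⟫ = ⟪u, e₁⟫ * ⟪u', e₁⟫ / ⟪e₁, e₁⟫ + ⟪u, e₂⟫ * ⟪u', e₂⟫ / ⟪e₂, e₂⟫ := by
  conv_lhs => rw [eq_expansion_of_inner_eq_zero hv h₁ h₂ o₁ o₂ o₁₂ hu]
  simp only [inner_add_left, real_inner_smul_left, real_inner_comm e₁ u', real_inner_comm e₂ u']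
  ring

/-- Three vectors with Gram matrix `[[4,2,2],[2,4,2],[2,2,4]]` (an equilateral triangle of side `2`
on `S²(2)`) are linearly independent. [folklore] -/
theorem linearIndependent_of_gram_triangle {p : Fin 3 → E3} (hd : ∀ i, ⟪p i, p i⟫ = 4)
    (ho : ∀ i j, i ≠ j → ⟪p i, p j⟫ = 2) : LinearIndependent ℝ p := by
  rw [Fintype.linearIndependent_iff]
  intro g hg i
  have h : ∀ j, ⟪∑ i, g i • p i, p j⟫ = 0 := fun j => by rw [hg, inner_zero_left]
  have e0 := h 0
  have e1 := h 1
  have e2 := h 2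
  simp only [inner_add_left, real_inner_smul_left, Fin.sum_univ_three, hd,
    ho 0 1 (by decide), ho 0 2 (by decide), ho 1 0 (by decide), ho 1 2 (by decide),
    ho 2 0 (by decide), ho 2 1 (by decide)] at e0 e1 e2
  have g0 : g 0 = 0 := by linarith
  have g1 : g 1 = 0 := by linarith
  have g2 : g 2 = 0 := by linarith
  fin_cases i <;> assumption

/-- **Congruence from equal Gram matrices.** Two triples of vectors of `ℝ³` with the same Gram
matrix, the first linearly independent, differ by a linear isometry of `ℝ³`. [folklore] -/
theorem exists_linearIsometry_of_inner_eq {p q : Fin 3 → E3} (hp : LinearIndependent ℝ p)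
    (h : ∀ i j, ⟪p i, p j⟫ = ⟪q i, q j⟫) : ∃ A : E3 →ₗᵢ[ℝ] E3, ∀ i, A (p i) = q i := by
  let b : Module.Basis (Fin 3) ℝ E3 := basisOfLinearIndependentOfCardEqFinrank hp (by simp)
  have hb : ∀ i, b i = p i := fun i => by
    simp [b, coe_basisOfLinearIndependentOfCardEqFinrank]
  let f : E3 →ₗ[ℝ] E3 := b.constr ℝ q
  have hf : ∀ i, f (p i) = q i := fun i => by rw [← hb]; exact b.constr_basis ℝ q i
  have hinner : ∀ x y, ⟪f x, f y⟫ = ⟪x, y⟫ := by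
    have : (innerₗ E3).compl₁₂ f f = innerₗ E3 := by
      refine LinearMap.ext_basis b b fun i j => ?_
      simp only [LinearMap.compl₁₂_apply, innerₗ_apply_apply, hb, hf, h]
    intro x y
    have := congrArg (fun B => B x y) this
    simpa using this
  exact ⟨f.isometryOfInner hinner, hf⟩

/-- **The rhombus lemma.** Let `v, a, w, c` be a closed chain of contacts on `S²(2)`
(`⟪v,a⟫ = ⟪a,w⟫ = ⟪w,c⟫ = ⟪c,v⟫ = 2`, all of squared norm `4`) with `v ≠ w` and `a ≠ c`. Then
`(4 + ⟪a, c⟫)(v + w) = 4(a + c)`: the two apexes `v, w` over the diagonal `a, c` are mirror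
images in the plane of `a, c`. In particular `(4 + ⟪a,c⟫)(4 + ⟪v,w⟫) = 16`, and if `⟪a,c⟫ = 0`
then `v + w = a + c` (a planar square). [cite: Hales2012, Lemma 10 (proof: "eight equilateral
triangles … rigidly determine V")] -/
theorem rhombus_smul_add_eq {v a w c : E3} (hvv : ⟪v, v⟫ = 4) (haa : ⟪a, a⟫ = 4) (hww : ⟪w, w⟫ = 4)
    (hcc : ⟪c, c⟫ = 4) (hva : ⟪v, a⟫ = 2) (hvc : ⟪v, c⟫ = 2) (hwa : ⟪w, a⟫ = 2) (hwc : ⟪w, c⟫ = 2)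
    (hvw : v ≠ w) (hac : a ≠ c) : (4 + ⟪a, c⟫) • (v + w) = (4 : ℝ) • (a + c) := by
  set n : E3 := v - w with hn
  have hn0 : n ≠ 0 := sub_ne_zero.2 hvw
  have hna : ⟪n, a⟫ = 0 := by rw [hn, inner_sub_left, hva, hwa, sub_self]
  have hnc : ⟪n, c⟫ = 0 := by rw [hn, inner_sub_left, hvc, hwc, sub_self]
  have hca : ⟪c, a⟫ = ⟪a, c⟫ := real_inner_comm a c
  -- `-4 < ⟪a, c⟫ < 4`
  have hlt : ⟪a, c⟫ < 4 := by
    have h1 : 0 < ⟪a - c, a - c⟫ := real_inner_self_pos.2 (sub_ne_zero.2 hac)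
    rw [inner_sub_left, inner_sub_right, inner_sub_right, haa, hcc, hca] at h1
    linarith
  have hgt : -4 < ⟪a, c⟫ := by
    have h1 : 0 ≤ ⟪a + c, a + c⟫ := real_inner_self_nonneg
    rw [inner_add_left, inner_add_right, inner_add_right, haa, hcc, hca] at h1
    have h2 : ⟪a, c⟫ ≠ -4 := by
      intro h4
      have h0 : ⟪a + c, a + c⟫ = 0 := by
        rw [inner_add_left, inner_add_right, inner_add_right, haa, hcc, hca, h4]; ring
      have hac' : a = -c := eq_neg_of_add_eq_zero_left (inner_self_eq_zero.1 h0)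
      rw [hac', inner_neg_right, hvc] at hva
      norm_num at hva
    rcases (show -4 ≤ ⟪a, c⟫ by linarith).eq_or_lt with h3 | h3
    · exact absurd h3.symm h2
    · exact h3
  -- `n, a, c` are linearly independent
  have hli : LinearIndependent ℝ ![n, a, c] := by
    rw [Fintype.linearIndependent_iff]
    intro g hg
    simp only [Fin.sum_univ_three, Matrix.cons_val_zero, Matrix.cons_val_one,
      Matrix.cons_val_two, Matrix.tail_cons, Matrix.head_cons] at hg
    have e0 : ⟪g 0 • n + g 1 • a + g 2 • c, n⟫ = 0 := by rw [hg, inner_zero_left]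
    have e1 : ⟪g 0 • n + g 1 • a + g 2 • c, a⟫ = 0 := by rw [hg, inner_zero_left]
    have e2 : ⟪g 0 • n + g 1 • a + g 2 • c, c⟫ = 0 := by rw [hg, inner_zero_left]
    simp only [inner_add_left, real_inner_smul_left, hna, hnc, haa, hcc, hca,
      real_inner_comm n a, real_inner_comm n c] at e0 e1 e2
    have hnn : 0 < ⟪n, n⟫ := real_inner_self_pos.2 hn0
    have g0 : g 0 = 0 := by
      have : g 0 * ⟪n, n⟫ = 0 := by linarith
      rcases mul_eq_zero.1 this with h | h
      · exact h
      · exact absurd h hnn.ne'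
    have g2 : g 2 = 0 := by
      have h16 : g 2 * (16 - ⟪a, c⟫ ^ 2) = 0 := by linear_combination 4 * e2 - ⟪a, c⟫ * e1
      rcases mul_eq_zero.1 h16 with h | h
      · exact h
      · nlinarith
    have g1 : g 1 = 0 := by nlinarith
    intro i
    fin_cases i <;> assumption
  -- the defect `m` is orthogonal to `n, a, c`, hence zero
  set m : E3 := (4 + ⟪a, c⟫) • (v + w) - (4 : ℝ) • (a + c) with hm
  have hm_n : ⟪m, n⟫ = 0 := by
    rw [hm, hn]
    simp only [inner_sub_left, inner_add_left, real_inner_smul_left, inner_sub_right, hvv, hww,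
      real_inner_comm v w, real_inner_comm v a, hva, real_inner_comm w a, hwa,
      real_inner_comm v c, hvc, real_inner_comm w c, hwc]
    ring
  have hm_a : ⟪m, a⟫ = 0 := by
    rw [hm]
    simp only [inner_sub_left, inner_add_left, real_inner_smul_left, hva, hwa, haa, hca]
    ring
  have hm_c : ⟪m, c⟫ = 0 := by
    rw [hm]
    simp only [inner_sub_left, inner_add_left, real_inner_smul_left, hvc, hwc, hcc]
    ring
  have h0 : m = 0 :=
    eq_zero_of_inner_linearIndependent_fin_three hli fun i => by
      fin_cases i
      · simpa using hm_n
      · simpa using hm_a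
      · simpa using hm_c
  exact sub_eq_zero.1 h0

/-- The scalar form of the rhombus lemma: `(4 + ⟪a, c⟫)(4 + ⟪v, w⟫) = 16`. [folklore] -/
theorem rhombus_inner_mul_eq {v a w c : E3} (hvv : ⟪v, v⟫ = 4) (hva : ⟪v, a⟫ = 2)
    (hvc : ⟪v, c⟫ = 2) (h : (4 + ⟪a, c⟫) • (v + w) = (4 : ℝ) • (a + c)) :
    (4 + ⟪a, c⟫) * (4 + ⟪v, w⟫) = 16 := by
  have := congrArg (fun z => ⟪v, z⟫) h
  simp only [real_inner_smul_right, inner_add_right, hvv, hva, hvc] at this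
  linarith

/-! ### Part C. The two vertex lemmas (tangent-plane coordinates) -/

/-- Two contacts `x, y` of `v` with `⟪x, y⟫ = −2` are symmetric about `v`: `x + y = v`.
[folklore] -/
theorem add_eq_of_inner_eq_neg_two {v x y : E3} (hvv : ⟪v, v⟫ = 4) (hxx : ⟪x, x⟫ = 4)
    (hyy : ⟪y, y⟫ = 4) (hvx : ⟪v, x⟫ = 2) (hvy : ⟪v, y⟫ = 2) (hxy : ⟪x, y⟫ = -2) : x + y = v := by
  rw [← sub_eq_zero, ← inner_self_eq_zero (𝕜 := ℝ)]
  simp only [inner_sub_left, inner_sub_right, inner_add_left, inner_add_right, hvv, hxx, hyy, hvx,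
    hvy, hxy, real_inner_comm v x, real_inner_comm v y, real_inner_comm x y]
  norm_num

/-- The reversed orientation is impossible: with `A = X + Y = 3X'` and `D = Y − 8X = 3Y'` one
has `8A² + D² = 648`, `A ≤ D`, `A ≤ −D`, hence `A² ≥ 72`, contradicting `−6 ≤ A ≤ 0`. [folklore] -/
theorem reversed_orientation_elim {X Y X' Y' : ℝ} (qc : 8 * X ^ 2 + Y ^ 2 = 72)
    (h1 : X' = (X + Y) / 3) (h2 : Y' = (Y - 8 * X) / 3) (hX : X ≤ 0) (hbd : X' + Y' ≤ 0)
    (hlow : -2 ≤ X') : False := by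
  have hA1 : X + Y ≤ Y - 8 * X := by linarith
  have hA2 : X + Y ≤ -(Y - 8 * X) := by linarith
  have hsq : (Y - 8 * X) ^ 2 ≤ (X + Y) ^ 2 := by
    have h0 := mul_nonneg (sub_nonneg.2 hA1) (by linarith : 0 ≤ -(Y - 8 * X) - (X + Y))
    nlinarith [h0]
  have h648 : 8 * (X + Y) ^ 2 + (Y - 8 * X) ^ 2 = 648 := by linear_combination 9 * qc
  have hAlow : -6 ≤ X + Y := by linarith
  have hAle : X + Y ≤ 0 := by linarith
  nlinarith [mul_nonneg (by linarith : 0 ≤ X + Y + 6) (by linarith : 0 ≤ -(X + Y))]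

/-- **Vertex lemma, type `(3,4,3,4)`.** Let `v ∈ S²(2)` have contacts `a, b` (a contact triangle
`vab`) and `c, d` (a contact triangle `vcd`), the four cross pairs being separated
(`⟪·,·⟫ ≤ σ ≤ 1`) and `⟪a, d⟫ ≥ −1`. Then in the tangent coordinates `X = 3 cos γ`,
`Y = 6√2 sin γ` of `c` (`8X² + Y² = 72`) one has `⟪a,c⟫ = 1 + X`, `⟪b,c⟫ = 1 + (X+Y)/3`,
`⟪a,d⟫ = 1 + (X−Y)/3`, `⟪b,d⟫ = 1 + X` — i.e. `d` follows `c` in the cyclic order `a, b, c, d`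
around `v` (the other orientation of the triangle `vcd` would put `a, d` within `1 − 2√2` of each
other's inner product, excluded by `⟪a,d⟫ ≥ −1`). [cite: Hales2012, Lemma 10 (proof)] -/
theorem vertex_tangent_coords {v a b c d : E3} (hvv : ⟪v, v⟫ = 4) (haa : ⟪a, a⟫ = 4)
    (hbb : ⟪b, b⟫ = 4) (hcc : ⟪c, c⟫ = 4) (hdd : ⟪d, d⟫ = 4) (hva : ⟪v, a⟫ = 2) (hvb : ⟪v, b⟫ = 2)
    (hvc : ⟪v, c⟫ = 2) (hvd : ⟪v, d⟫ = 2) (hab : ⟪a, b⟫ = 2) (hcd : ⟪c, d⟫ = 2) {σ : ℝ}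
    (hσ : σ ≤ 1) (hac : ⟪a, c⟫ ≤ σ) (hbd : ⟪b, d⟫ ≤ σ) (had' : -1 ≤ ⟪a, d⟫) :
    ∃ X Y : ℝ, 8 * X ^ 2 + Y ^ 2 = 72 ∧ ⟪a, c⟫ = 1 + X ∧ ⟪b, c⟫ = 1 + (X + Y) / 3 ∧
      ⟪a, d⟫ = 1 + (X - Y) / 3 ∧ ⟪b, d⟫ = 1 + X := by
  -- tangent frame at `v`
  set e₁ : E3 := a - (1 / 2 : ℝ) • v with he₁
  set e₂ : E3 := (3 : ℝ) • b - a - v with he₂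
  have hv0 : v ≠ 0 := fun h => by rw [h, inner_zero_left] at hvv; norm_num at hvv
  have h11 : ⟪e₁, e₁⟫ = 3 := by
    rw [he₁]; simp only [inner_sub_left, inner_sub_right, real_inner_smul_left,
      real_inner_smul_right, haa, hvv, hva, real_inner_comm v a]; norm_num
  have h22 : ⟪e₂, e₂⟫ = 24 := by
    rw [he₂]; simp only [inner_sub_left, inner_sub_right, real_inner_smul_left,
      real_inner_smul_right, haa, hbb, hvv, hva, hvb, hab, real_inner_comm v a,
      real_inner_comm v b, real_inner_comm a b]; norm_num
  have h10 : e₁ ≠ 0 := fun h => by rw [h, inner_zero_left] at h11; norm_num at h11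
  have h20 : e₂ ≠ 0 := fun h => by rw [h, inner_zero_left] at h22; norm_num at h22
  have o₁ : ⟪v, e₁⟫ = 0 := by
    rw [he₁]; simp only [inner_sub_right, real_inner_smul_right, hvv, hva]; norm_num
  have o₂ : ⟪v, e₂⟫ = 0 := by
    rw [he₂]; simp only [inner_sub_right, real_inner_smul_right, hvv, hva, hvb]; norm_num
  have o₁₂ : ⟪e₁, e₂⟫ = 0 := by
    rw [he₁, he₂]; simp only [inner_sub_left, inner_sub_right, real_inner_smul_left,
      real_inner_smul_right, haa, hvv, hva, hvb, hab, real_inner_comm v a]; norm_num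
  -- tangent vectors of `c` and `d`
  set c' : E3 := c - (1 / 2 : ℝ) • v with hc'
  set d' : E3 := d - (1 / 2 : ℝ) • v with hd'
  have hc'v : ⟪c', v⟫ = 0 := by
    rw [hc']; simp only [inner_sub_left, real_inner_smul_left, hvv, real_inner_comm v c, hvc]
    norm_num
  have hd'v : ⟪d', v⟫ = 0 := by
    rw [hd']; simp only [inner_sub_left, real_inner_smul_left, hvv, real_inner_comm v d, hvd]
    norm_num
  set X := ⟪c', e₁⟫ with hX
  set Y := ⟪c', e₂⟫ with hY
  set X' := ⟪d', e₁⟫ with hX'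
  set Y' := ⟪d', e₂⟫ with hY'
  clear_value X Y X' Y' c' d' e₁ e₂
  have eX : X = ⟪a, c⟫ - 1 := by
    rw [hX, hc', he₁]; simp only [inner_sub_left, inner_sub_right, real_inner_smul_left,
      real_inner_smul_right, hvv, hva, hvc, real_inner_comm v c, real_inner_comm a c]; norm_num
  have eY : Y = 3 * ⟪b, c⟫ - ⟪a, c⟫ - 2 := by
    rw [hY, hc', he₂]; simp only [inner_sub_left, inner_sub_right, real_inner_smul_left,
      real_inner_smul_right, hvv, hva, hvb, hvc, real_inner_comm v c, real_inner_comm a c,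
      real_inner_comm b c]; norm_num; ring
  have eX' : X' = ⟪a, d⟫ - 1 := by
    rw [hX', hd', he₁]; simp only [inner_sub_left, inner_sub_right, real_inner_smul_left,
      real_inner_smul_right, hvv, hva, hvd, real_inner_comm v d, real_inner_comm a d]; norm_num
  have eY' : Y' = 3 * ⟪b, d⟫ - ⟪a, d⟫ - 2 := by
    rw [hY', hd', he₂]; simp only [inner_sub_left, inner_sub_right, real_inner_smul_left,
      real_inner_smul_right, hvv, hva, hvb, hvd, real_inner_comm v d, real_inner_comm a d,
      real_inner_comm b d]; norm_num; ring
  -- the three quadratic relations from the two-dimensionality of the tangent plane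
  have F := fun (u : E3) (u' : E3) (hu : ⟪u, v⟫ = 0) =>
    inner_eq_of_inner_eq_zero hv0 h10 h20 o₁ o₂ o₁₂ u' hu
  have qc : 8 * X ^ 2 + Y ^ 2 = 72 := by
    have h := F c' c' hc'v
    rw [← hX, ← hY, h11, h22] at h
    have : ⟪c', c'⟫ = 3 := by
      rw [hc']; simp only [inner_sub_left, inner_sub_right, real_inner_smul_left,
        real_inner_smul_right, hvv, hcc, hvc, real_inner_comm v c]; norm_num
    rw [this] at h
    linarith
  have qd : 8 * X' ^ 2 + Y' ^ 2 = 72 := by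
    have h := F d' d' hd'v
    rw [← hX', ← hY', h11, h22] at h
    have : ⟪d', d'⟫ = 3 := by
      rw [hd']; simp only [inner_sub_left, inner_sub_right, real_inner_smul_left,
        real_inner_smul_right, hvv, hdd, hvd, real_inner_comm v d]; norm_num
    rw [this] at h
    linarith
  have qcd : 8 * (X * X') + Y * Y' = 24 := by
    have h := F c' d' hc'v
    rw [← hX, ← hY, ← hX', ← hY', h11, h22] at h
    have : ⟪c', d'⟫ = 1 := by
      rw [hc', hd']; simp only [inner_sub_left, inner_sub_right, real_inner_smul_left,
        real_inner_smul_right, hvv, hcd, hvc, hvd, real_inner_comm v c]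
      norm_num
    rw [this] at h
    linarith
  -- hence `X Y' − Y X' = ± 24`
  have hQ : (X * Y' - Y * X') ^ 2 = 24 ^ 2 := by
    linear_combination (1 / 8 : ℝ) * (8 * X' ^ 2 + Y' ^ 2) * qc + 9 * qd -
      (1 / 8 : ℝ) * (8 * (X * X') + Y * Y' + 24) * qcd
  have solX' : 72 * X' = 24 * X - Y * (X * Y' - Y * X') := by
    linear_combination (-X') * qc + X * qcd
  have solY' : 72 * Y' = 8 * X * (X * Y' - Y * X') + 24 * Y := by
    linear_combination (-Y') * qc + Y * qcd
  rcases sq_eq_sq_iff_eq_or_eq_neg.1 hQ with hq | hq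
  · -- the admissible orientation
    refine ⟨X, Y, qc, by linarith, by linarith, ?_, ?_⟩
    · rw [hq] at solX'; linarith
    · rw [hq] at solX' solY'
      have h1 : X' = (X - Y) / 3 := by linarith
      have h2 : Y' = (8 * X + Y) / 3 := by linarith
      linarith
  · -- the reversed orientation contradicts `⟪a, d⟫ ≥ −1`
    exfalso
    rw [hq] at solX' solY'
    have h1 : X' = (X + Y) / 3 := by linarith
    have h2 : Y' = (Y - 8 * X) / 3 := by linarith
    have hXle : X ≤ 0 := by linarith
    have hbd' : X' + Y' ≤ 0 := by rw [eX', eY']; linarith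
    have hlow : -2 ≤ X' := by linarith
    exact reversed_orientation_elim qc h1 h2 hXle hbd' hlow

/-- **Vertex lemma, type `(3,3,4,4)`.** Let `h ∈ S²(2)` have contacts `e, u, l, k` with `heu` and
`hel` contact triangles sharing the edge `he`, `u, l` separated and `k` separated from `u` and `l`
(`⟪·,·⟫ ≤ σ ≤ 1`). Then `3u + 3l = 2h + 2e` (the two triangles are mirror images in their common
edge), and in the tangent coordinates `X, Y` of `k` (`8X² + Y² = 72`): `⟪k,e⟫ = 1 + X`,
`⟪k,u⟫ = 1 + (X+Y)/3`, `⟪k,l⟫ = 1 + (X−Y)/3`. (The vertices of the hexagonal layer of the HCP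
configuration.) [cite: Hales2012, Lemma 10 (proof)] -/
theorem vertex_tangent_coords' {h e u l k : E3} (hhh : ⟪h, h⟫ = 4) (hee : ⟪e, e⟫ = 4)
    (huu : ⟪u, u⟫ = 4) (hll : ⟪l, l⟫ = 4) (hkk : ⟪k, k⟫ = 4) (hhe : ⟪h, e⟫ = 2) (hhu : ⟪h, u⟫ = 2)
    (hhl : ⟪h, l⟫ = 2) (hhk : ⟪h, k⟫ = 2) (heu : ⟪e, u⟫ = 2) (hel : ⟪e, l⟫ = 2) {σ : ℝ}
    (hσ : σ ≤ 1) (hul : ⟪u, l⟫ ≤ σ) :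
    (3 : ℝ) • u + (3 : ℝ) • l = (2 : ℝ) • h + (2 : ℝ) • e ∧
    ∃ X Y : ℝ, 8 * X ^ 2 + Y ^ 2 = 72 ∧ ⟪k, e⟫ = 1 + X ∧ ⟪k, u⟫ = 1 + (X + Y) / 3 ∧
      ⟪k, l⟫ = 1 + (X - Y) / 3 := by
  set e₁ : E3 := e - (1 / 2 : ℝ) • h with he₁
  set e₂ : E3 := (3 : ℝ) • u - e - h with he₂
  have hv0 : h ≠ 0 := fun h0 => by rw [h0, inner_zero_left] at hhh; norm_num at hhh
  have h11 : ⟪e₁, e₁⟫ = 3 := by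
    rw [he₁]; simp only [inner_sub_left, inner_sub_right, real_inner_smul_left,
      real_inner_smul_right, hee, hhh, hhe, real_inner_comm h e]; norm_num
  have h22 : ⟪e₂, e₂⟫ = 24 := by
    rw [he₂]; simp only [inner_sub_left, inner_sub_right, real_inner_smul_left,
      real_inner_smul_right, hee, huu, hhh, hhe, hhu, heu, real_inner_comm h e,
      real_inner_comm h u, real_inner_comm e u]; norm_num
  have h10 : e₁ ≠ 0 := fun h0 => by rw [h0, inner_zero_left] at h11; norm_num at h11
  have h20 : e₂ ≠ 0 := fun h0 => by rw [h0, inner_zero_left] at h22; norm_num at h22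
  have o₁ : ⟪h, e₁⟫ = 0 := by
    rw [he₁]; simp only [inner_sub_right, real_inner_smul_right, hhh, hhe]; norm_num
  have o₂ : ⟪h, e₂⟫ = 0 := by
    rw [he₂]; simp only [inner_sub_right, real_inner_smul_right, hhh, hhe, hhu]; norm_num
  have o₁₂ : ⟪e₁, e₂⟫ = 0 := by
    rw [he₁, he₂]; simp only [inner_sub_left, inner_sub_right, real_inner_smul_left,
      real_inner_smul_right, hee, hhh, hhe, hhu, heu, real_inner_comm h e]; norm_num
  set l' : E3 := l - (1 / 2 : ℝ) • h with hl'
  set k' : E3 := k - (1 / 2 : ℝ) • h with hk'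
  have hl'v : ⟪l', h⟫ = 0 := by
    rw [hl']; simp only [inner_sub_left, real_inner_smul_left, hhh, real_inner_comm h l, hhl]
    norm_num
  have hk'v : ⟪k', h⟫ = 0 := by
    rw [hk']; simp only [inner_sub_left, real_inner_smul_left, hhh, real_inner_comm h k, hhk]
    norm_num
  have eXl : ⟪l', e₁⟫ = 1 := by
    rw [hl', he₁]; simp only [inner_sub_left, inner_sub_right, real_inner_smul_left,
      real_inner_smul_right, hhh, hhe, hhl, real_inner_comm h l, real_inner_comm e l, hel]
    norm_num
  have eYl : ⟪l', e₂⟫ = 3 * ⟪u, l⟫ - 4 := by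
    rw [hl', he₂]; simp only [inner_sub_left, inner_sub_right, real_inner_smul_left,
      real_inner_smul_right, hhh, hhe, hhu, hhl, real_inner_comm h l, real_inner_comm e l, hel,
      real_inner_comm u l]; norm_num; ring
  have F := fun (w : E3) (w' : E3) (hw : ⟪w, h⟫ = 0) =>
    inner_eq_of_inner_eq_zero hv0 h10 h20 o₁ o₂ o₁₂ w' hw
  -- `l` is the mirror image of `u` in the edge `he`
  have hYl : ⟪l', e₂⟫ = -8 := by
    have q := F l' l' hl'v
    rw [eXl, h11, h22] at q
    have : ⟪l', l'⟫ = 3 := by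
      rw [hl']; simp only [inner_sub_left, inner_sub_right, real_inner_smul_left,
        real_inner_smul_right, hhh, hll, hhl, real_inner_comm h l]; norm_num
    rw [this] at q
    have hsq : ⟪l', e₂⟫ ^ 2 = 8 ^ 2 := by nlinarith
    rcases sq_eq_sq_iff_eq_or_eq_neg.1 hsq with h8 | h8
    · exfalso; rw [eYl] at h8; linarith
    · exact h8
  refine ⟨?_, ?_⟩
  · have hexp := eq_expansion_of_inner_eq_zero hv0 h10 h20 o₁ o₂ o₁₂ hl'v
    rw [eXl, hYl, h11, h22] at hexp
    rw [hl', he₁, he₂] at hexp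
    have : (3 : ℝ) • u + (3 : ℝ) • l - ((2 : ℝ) • h + (2 : ℝ) • e) =
        (-3 : ℝ) • ((1 / 3 : ℝ) • (e - (1 / 2 : ℝ) • h) + (-8 / 24 : ℝ) • ((3 : ℝ) • u - e - h)
          - (l - (1 / 2 : ℝ) • h)) := by module
    rw [← hexp, sub_self, smul_zero, sub_eq_zero] at this
    exact this
  · set X := ⟪k', e₁⟫ with hX
    set Y := ⟪k', e₂⟫ with hY
    clear_value X Y k' l' e₁ e₂
    have eX : X = ⟪k, e⟫ - 1 := by
      rw [hX, hk', he₁]; simp only [inner_sub_left, inner_sub_right, real_inner_smul_left,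
        real_inner_smul_right, hhh, hhe, hhk, real_inner_comm h k, real_inner_comm e k]; norm_num
    have eY : Y = 3 * ⟪k, u⟫ - ⟪k, e⟫ - 2 := by
      rw [hY, hk', he₂]; simp only [inner_sub_left, inner_sub_right, real_inner_smul_left,
        real_inner_smul_right, hhh, hhe, hhu, hhk, real_inner_comm h k, real_inner_comm e k,
        real_inner_comm u k]; norm_num; ring
    have qk : 8 * X ^ 2 + Y ^ 2 = 72 := by
      have q := F k' k' hk'v
      rw [← hX, ← hY, h11, h22] at q
      have : ⟪k', k'⟫ = 3 := by
        rw [hk']; simp only [inner_sub_left, inner_sub_right, real_inner_smul_left,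
          real_inner_smul_right, hhh, hkk, hhk, real_inner_comm h k]; norm_num
      rw [this] at q
      linarith
    have qkl : ⟪k, l⟫ = 1 + (X - Y) / 3 := by
      have q := F k' l' hk'v
      rw [← hX, ← hY, eXl, hYl, h11, h22] at q
      have : ⟪k', l'⟫ = ⟪k, l⟫ - 1 := by
        rw [hk', hl']; simp only [inner_sub_left, inner_sub_right, real_inner_smul_left,
          real_inner_smul_right, hhh, hhk, hhl, real_inner_comm h k]
        norm_num
      rw [this] at q
      linarith
    exact ⟨X, Y, qk, by linarith, by linarith, qkl⟩

/-! ### Part D. Realizations of an abstract contact pattern -/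

/-- **A realization on `S²(2)` of an abstract contact pattern** `adj` on an index type `ι`, with
separation constant `σ < 8/9`: points `x i` of squared norm `4`, adjacent indices at inner product
`2` (distance `2`), distinct non-adjacent indices at inner product `≤ σ` (distance
`≥ √(8 − 2σ)`; Hales's `2h₀ = 2.52` gives `σ = 4 − 2h₀² = 0.8248`). [cite: Hales2012, Definition 1
and Lemma 10] -/
structure IsRealization {ι : Type*} (adj : ι → ι → Prop) (σ : ℝ) (x : ι → E3) : Prop where
  sigma_lt : σ < 8 / 9
  inner_self : ∀ i, ⟪x i, x i⟫ = 4
  inner_adj : ∀ ⦃i j⦄, adj i j → ⟪x i, x j⟫ = 2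
  inner_le : ∀ ⦃i j⦄, i ≠ j → ¬adj i j → ⟪x i, x j⟫ ≤ σ

namespace IsRealization

variable {ι : Type*} {adj : ι → ι → Prop} {σ : ℝ} {x : ι → E3}

/-- `σ ≤ 1`. [folklore] -/
theorem sigma_le_one (hx : IsRealization adj σ x) : σ ≤ 1 := by linarith [hx.sigma_lt]

/-- Separated indices carry distinct points. [folklore] -/
theorem ne (hx : IsRealization adj σ x) {i j : ι} (h : i ≠ j ∧ ¬adj i j) : x i ≠ x j := by
  intro he
  have h1 := hx.inner_le h.1 h.2
  rw [he, hx.inner_self] at h1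
  linarith [hx.sigma_lt]

/-- The pattern of a contact square `v a w c` (diagonals `v w` and `a c` separated). [folklore] -/
def SquarePattern (adj : ι → ι → Prop) (v a w c : ι) : Prop :=
  adj v a ∧ adj v c ∧ adj w a ∧ adj w c ∧ (v ≠ w ∧ ¬adj v w) ∧ (a ≠ c ∧ ¬adj a c)

/-- Square patterns are decidable for a decidable relation (checked by `decide` on the models).
[folklore] -/
instance [DecidableEq ι] [DecidableRel adj] (v a w c : ι) :
    Decidable (SquarePattern adj v a w c) := by
  unfold SquarePattern; infer_instance

/-- The rhombus lemma for a contact square of a realization. [cite: Hales2012, Lemma 10 (proof)] -/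
theorem smul_add_eq (hx : IsRealization adj σ x) {v a w c : ι} (H : SquarePattern adj v a w c) :
    (4 + ⟪x a, x c⟫) • (x v + x w) = (4 : ℝ) • (x a + x c) :=
  rhombus_smul_add_eq (hx.inner_self v) (hx.inner_self a) (hx.inner_self w) (hx.inner_self c)
    (hx.inner_adj H.1) (hx.inner_adj H.2.1) (hx.inner_adj H.2.2.1) (hx.inner_adj H.2.2.2.1)
    (hx.ne H.2.2.2.2.1) (hx.ne H.2.2.2.2.2)

/-- `(4 + ⟪a, c⟫)(4 + ⟪v, w⟫) = 16` for a contact square. [folklore] -/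
theorem inner_mul_eq (hx : IsRealization adj σ x) {v a w c : ι} (H : SquarePattern adj v a w c) :
    (4 + ⟪x a, x c⟫) * (4 + ⟪x v, x w⟫) = 16 :=
  rhombus_inner_mul_eq (hx.inner_self v) (hx.inner_adj H.1) (hx.inner_adj H.2.1)
    (hx.smul_add_eq H)

/-- The points of a realization have norm `2`. [folklore] -/
theorem norm_eq (hx : IsRealization adj σ x) (i : ι) : ‖x i‖ = 2 := by
  have h := hx.inner_self i
  rw [real_inner_self_eq_norm_sq] at h
  nlinarith [norm_nonneg (x i)]

/-- Inner products of points of a realization are `≥ −4`. [folklore] -/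
theorem neg_four_le (hx : IsRealization adj σ x) (i j : ι) : -4 ≤ ⟪x i, x j⟫ := by
  have h := abs_real_inner_le_norm (x i) (x j)
  rw [hx.norm_eq, hx.norm_eq] at h
  have := neg_abs_le ⟪x i, x j⟫
  linarith

/-- Hence a diagonal of a contact square has inner product `≥ −1` (the other one being
separated). [folklore] -/
theorem neg_one_le (hx : IsRealization adj σ x) {v a w c : ι} (H : SquarePattern adj v a w c) :
    -1 ≤ ⟪x a, x c⟫ := by
  have h1 := hx.inner_mul_eq H
  have h2 := hx.inner_le H.2.2.2.2.1.1 H.2.2.2.2.1.2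
  have h3 := hx.sigma_lt
  have h4 := hx.neg_four_le a c
  by_contra hlt
  push Not at hlt
  have h5 : (4 + ⟪x a, x c⟫) * (4 + ⟪x v, x w⟫) ≤ (4 + ⟪x a, x c⟫) * (4 + 8 / 9) :=
    mul_le_mul_of_nonneg_left (by linarith) (by linarith)
  nlinarith

/-- **The rhombus inequality for a contact square of a realization**, with the case of
equality. [cite: Hales2012, Lemma 10 (proof)] -/
theorem square (hx : IsRealization adj σ x) {v a w c : ι} (H : SquarePattern adj v a w c) :
    tangentAngle ⟪x a, x c⟫ + tangentAngle ⟪x v, x w⟫ ≤ 2 * tangentAngle 0 ∧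
      (tangentAngle ⟪x a, x c⟫ + tangentAngle ⟪x v, x w⟫ = 2 * tangentAngle 0 →
        ⟪x a, x c⟫ = 0 ∧ ⟪x v, x w⟫ = 0) :=
  tangentAngle_add_le hx.sigma_lt (hx.inner_le H.2.2.2.2.2.1 H.2.2.2.2.2.2)
    (hx.inner_le H.2.2.2.2.1.1 H.2.2.2.2.1.2) (by linarith [hx.neg_one_le H]) (hx.inner_mul_eq H)

/-- A contact square with perpendicular diagonal `a c` is a planar parallelogram:
`v + w = a + c`. [folklore] -/
theorem square_add (hx : IsRealization adj σ x) {v a w c : ι} (H : SquarePattern adj v a w c)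
    (h0 : ⟪x a, x c⟫ = 0) : x v + x w = x a + x c := by
  have h := hx.smul_add_eq H
  rw [h0, add_zero] at h
  exact smul_right_injective E3 (by norm_num : (4 : ℝ) ≠ 0) h

/-- The pattern of a vertex `v` of type `(3,4,3,4)`: contact triangles `v a b`, `v c d`, contact
squares through `a, d` (completed by `w`) and through `b, c`. [folklore] -/
def VertexPattern (adj : ι → ι → Prop) (v a b c d w : ι) : Prop :=
  adj v a ∧ adj v b ∧ adj v c ∧ adj v d ∧ adj a b ∧ adj c d ∧ (a ≠ c ∧ ¬adj a c) ∧
    (b ≠ d ∧ ¬adj b d) ∧ (b ≠ c ∧ ¬adj b c) ∧ SquarePattern adj v a w d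

/-- Vertex patterns are decidable for a decidable relation. [folklore] -/
instance [DecidableEq ι] [DecidableRel adj] (v a b c d w : ι) :
    Decidable (VertexPattern adj v a b c d w) := by
  unfold VertexPattern; infer_instance

/-- **The vertex lemma at a vertex of type `(3,4,3,4)` of a realization**: the two square angles
at `v` sum to `2 arccos (−1/3)`; and if both squares have perpendicular diagonals, the two "far"
pairs are symmetric about `v`. [cite: Hales2012, Lemma 10 (proof)] -/
theorem vertex (hx : IsRealization adj σ x) {v a b c d w : ι} (H : VertexPattern adj v a b c d w) :
    tangentAngle ⟪x b, x c⟫ + tangentAngle ⟪x a, x d⟫ = 2 * tangentAngle 0 ∧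
      (⟪x b, x c⟫ = 0 → ⟪x a, x d⟫ = 0 → x a + x c = x v ∧ x b + x d = x v) := by
  obtain ⟨hva, hvb, hvc, hvd, hab, hcd, hac, hbd, hbc, hsq⟩ := H
  have had := hsq.2.2.2.2.2
  obtain ⟨X, Y, q, eac, ebc, ead, ebd⟩ := vertex_tangent_coords (hx.inner_self v)
    (hx.inner_self a) (hx.inner_self b) (hx.inner_self c) (hx.inner_self d) (hx.inner_adj hva)
    (hx.inner_adj hvb) (hx.inner_adj hvc) (hx.inner_adj hvd) (hx.inner_adj hab) (hx.inner_adj hcd)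
    hx.sigma_le_one (hx.inner_le hac.1 hac.2) (hx.inner_le hbd.1 hbd.2) (hx.neg_one_le hsq)
  have h1 := hx.inner_le hbc.1 hbc.2
  have h2 := hx.inner_le had.1 had.2
  have hσ := hx.sigma_le_one
  refine ⟨?_, fun h0 h0' => ?_⟩
  · have e1 : tangentAngle ⟪x b, x c⟫ = arccos ((X + Y) / 9) := by
      rw [tangentAngle, ebc]; congr 1; ring
    have e2 : tangentAngle ⟪x a, x d⟫ = arccos ((X - Y) / 9) := by
      rw [tangentAngle, ead]; congr 1; ring
    rw [e1, e2, tangentAngle_zero]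
    exact arccos_add_arccos_eq_of_ellipse q (by linarith) (by linarith)
  · have hX : X = -3 := by linarith
    have h3 : ⟪x a, x c⟫ = -2 := by rw [eac, hX]; norm_num
    have h4 : ⟪x b, x d⟫ = -2 := by rw [ebd, hX]; norm_num
    exact ⟨add_eq_of_inner_eq_neg_two (hx.inner_self v) (hx.inner_self a) (hx.inner_self c)
        (hx.inner_adj hva) (hx.inner_adj hvc) h3,
      add_eq_of_inner_eq_neg_two (hx.inner_self v) (hx.inner_self b) (hx.inner_self d)
        (hx.inner_adj hvb) (hx.inner_adj hvd) h4⟩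

/-- The pattern of a vertex `h` of type `(3,3,4,4)`: contact triangles `h e u`, `h e l` sharing
the edge `h e`, and a fourth contact `k` of `h`, separated from `u` and `l`. [folklore] -/
def VertexPattern' (adj : ι → ι → Prop) (h e u l k : ι) : Prop :=
  adj h e ∧ adj h u ∧ adj h l ∧ adj h k ∧ adj e u ∧ adj e l ∧ (u ≠ l ∧ ¬adj u l) ∧
    (k ≠ u ∧ ¬adj k u) ∧ (k ≠ l ∧ ¬adj k l)

/-- Vertex patterns are decidable for a decidable relation. [folklore] -/
instance [DecidableEq ι] [DecidableRel adj] (h e u l k : ι) :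
    Decidable (VertexPattern' adj h e u l k) := by
  unfold VertexPattern'; infer_instance

/-- **The vertex lemma at a vertex of type `(3,3,4,4)` of a realization.**
[cite: Hales2012, Lemma 10 (proof)] -/
theorem vertex' (hx : IsRealization adj σ x) {h e u l k : ι} (H : VertexPattern' adj h e u l k) :
    tangentAngle ⟪x k, x u⟫ + tangentAngle ⟪x k, x l⟫ = 2 * tangentAngle 0 ∧
      (3 : ℝ) • x u + (3 : ℝ) • x l = (2 : ℝ) • x h + (2 : ℝ) • x e ∧
      (⟪x k, x u⟫ = 0 → ⟪x k, x l⟫ = 0 → x k + x e = x h) := by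
  obtain ⟨hhe, hhu, hhl, hhk, heu, hel, hul, hku, hkl⟩ := H
  obtain ⟨hlin, X, Y, q, eke, eku, ekl⟩ := vertex_tangent_coords' (hx.inner_self h)
    (hx.inner_self e) (hx.inner_self u) (hx.inner_self l) (hx.inner_self k) (hx.inner_adj hhe)
    (hx.inner_adj hhu) (hx.inner_adj hhl) (hx.inner_adj hhk) (hx.inner_adj heu) (hx.inner_adj hel)
    hx.sigma_le_one (hx.inner_le hul.1 hul.2)
  have h1 := hx.inner_le hku.1 hku.2
  have h2 := hx.inner_le hkl.1 hkl.2
  have hσ := hx.sigma_le_one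
  refine ⟨?_, hlin, fun h0 h0' => ?_⟩
  · have e1 : tangentAngle ⟪x k, x u⟫ = arccos ((X + Y) / 9) := by
      rw [tangentAngle, eku]; congr 1; ring
    have e2 : tangentAngle ⟪x k, x l⟫ = arccos ((X - Y) / 9) := by
      rw [tangentAngle, ekl]; congr 1; ring
    rw [e1, e2, tangentAngle_zero]
    exact arccos_add_arccos_eq_of_ellipse q (by linarith) (by linarith)
  · have hX : X = -3 := by linarith
    have h3 : ⟪x k, x e⟫ = -2 := by rw [eke, hX]; norm_num
    exact add_eq_of_inner_eq_neg_two (hx.inner_self h) (hx.inner_self k) (hx.inner_self e)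
      (hx.inner_adj hhk) (hx.inner_adj hhe) h3

end IsRealization

/-! ### Part E. The two model patterns: tables, contact relations, reference points -/

/-- The twelve FCC integer vectors (`fccInt`), enumerated. [cite: ConwaySloane1999, Ch. 4 §6.3] -/
def fccTab : Fin 12 → Fin 3 → ℤ :=
  ![![1, 1, 0], ![1, -1, 0], ![-1, 1, 0], ![-1, -1, 0],
    ![1, 0, 1], ![1, 0, -1], ![-1, 0, 1], ![-1, 0, -1],
    ![0, 1, 1], ![0, 1, -1], ![0, -1, 1], ![0, -1, -1]]

/-- The twelve HCP integer vectors (`hcpInt`, scaled by `3`), enumerated: hexagonal layer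
(`0–5`), upper triangle (`6–8`), lower triangle (`9–11`). [cite: HalesDSP2012, §1.3, Fig. 1.11] -/
def hcpTab : Fin 12 → Fin 3 → ℤ :=
  ![![3, -3, 0], ![-3, 3, 0], ![3, 0, -3], ![-3, 0, 3], ![0, 3, -3], ![0, -3, 3],
    ![3, 3, 0], ![3, 0, 3], ![0, 3, 3],
    ![-1, -1, -4], ![-1, -4, -1], ![-4, -1, -1]]

/-- **The FCC contact relation** (cuboctahedron graph): `i ~ j` iff `|tᵢ − tⱼ|² = 2`.
[cite: Hales2012, §7 (FCC contact hypermap)] -/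
abbrev fccAdj (i j : Fin 12) : Prop := sqNormInt (fccTab i - fccTab j) = 2

/-- **The HCP contact relation** (anticuboctahedron graph): `i ~ j` iff `|tᵢ − tⱼ|² = 18`.
[cite: Hales2012, §7 (HCP contact hypermap)] -/
abbrev hcpAdj (i j : Fin 12) : Prop := sqNormInt (hcpTab i - hcpTab j) = 18

/-- The integer dot product on `ℤ³`. [folklore] -/
def dotInt (s t : Fin 3 → ℤ) : ℤ := s 0 * t 0 + s 1 * t 1 + s 2 * t 2

/-- The reference point `2 t/√N ∈ S²(2)` of an integer vector `t` of squared norm `N`.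
[folklore] -/
def refPt (N : ℕ) (t : Fin 3 → ℤ) : E3 := (2 : ℝ) • ((Real.sqrt N)⁻¹ • intVec t)

/-- The FCC reference configuration `2 · fccKissingPattern`, enumerated. [folklore] -/
abbrev fccRef (i : Fin 12) : E3 := refPt 2 (fccTab i)

/-- The HCP reference configuration `2 · hcpKissingPattern`, enumerated. [folklore] -/
abbrev hcpRef (i : Fin 12) : E3 := refPt 18 (hcpTab i)

/-- `intVec` is additive. [folklore] -/
theorem intVec_add (v w : Fin 3 → ℤ) : intVec (v + w) = intVec v + intVec w := by
  ext i; simp [intVec]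

/-- `intVec` commutes with integer scaling. [folklore] -/
theorem intVec_zsmul (n : ℤ) (v : Fin 3 → ℤ) : intVec (n • v) = (n : ℝ) • intVec v := by
  ext i; simp [intVec]

/-- `⟪intVec s, intVec t⟫ = s · t`. [folklore] -/
theorem inner_intVec (s t : Fin 3 → ℤ) : ⟪intVec s, intVec t⟫ = (dotInt s t : ℝ) := by
  rw [EuclideanSpace.inner_eq_star_dotProduct, dotProduct, Fin.sum_univ_three]
  simp [intVec, dotInt]
  ring

/-- `refPt` is additive. [folklore] -/
theorem refPt_add (N : ℕ) (s t : Fin 3 → ℤ) : refPt N (s + t) = refPt N s + refPt N t := by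
  simp only [refPt, intVec_add, smul_add]

/-- `refPt` commutes with integer scaling. [folklore] -/
theorem refPt_intSmul (N : ℕ) (n : ℤ) (t : Fin 3 → ℤ) : refPt N (n • t) = (n : ℝ) • refPt N t := by
  simp only [refPt, intVec_zsmul, smul_comm (n : ℝ)]

/-- `⟪refPt N s, refPt N t⟫ = (4/N) (s · t)`. [folklore] -/
theorem inner_refPt (N : ℕ) (s t : Fin 3 → ℤ) :
    ⟪refPt N s, refPt N t⟫ = 4 / N * (dotInt s t : ℝ) := by
  rw [refPt, refPt, real_inner_smul_left, real_inner_smul_right, real_inner_smul_left,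
    real_inner_smul_right, inner_intVec, ← Real.sqrt_inv, ← mul_assoc, ← mul_assoc, ← mul_assoc,
    show (2 : ℝ) * 2 * √((N : ℝ)⁻¹) * √((N : ℝ)⁻¹) = 4 * (√((N : ℝ)⁻¹) * √((N : ℝ)⁻¹)) by ring,
    Real.mul_self_sqrt (by positivity)]
  ring

/-- Distances between reference points: `dist = 2` iff the integer vectors differ by squared
norm `N` (`N ≠ 0`). [folklore] -/
theorem dist_refPt_eq_two_iff {N : ℕ} (hN : N ≠ 0) (s t : Fin 3 → ℤ) :
    dist (refPt N s) (refPt N t) = 2 ↔ sqNormInt (s - t) = N := by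
  rw [refPt, refPt, dist_two_smul_scaled]
  have hpos : (0 : ℝ) < Real.sqrt N := by positivity
  constructor
  · intro h
    have h1 : Real.sqrt (sqNormInt (s - t) : ℝ) = Real.sqrt N := by
      field_simp at h; linarith
    have h0 : (0 : ℝ) ≤ sqNormInt (s - t) := by
      have : (0 : ℤ) ≤ sqNormInt (s - t) := by unfold sqNormInt; positivity
      exact_mod_cast this
    have h2 := congrArg (· ^ 2) h1
    simp only [Real.sq_sqrt h0, Real.sq_sqrt (Nat.cast_nonneg N)] at h2
    exact_mod_cast h2
  · intro h
    rw [h, Int.cast_natCast, inv_mul_cancel₀ hpos.ne', mul_one]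

/-- Reference points lie on `S²(2)`. [folklore] -/
theorem norm_refPt {N : ℕ} (hN : N ≠ 0) {t : Fin 3 → ℤ} (ht : sqNormInt t = N) :
    ‖refPt N t‖ = 2 := by
  have hpos : (0 : ℝ) < Real.sqrt N := by positivity
  rw [refPt, norm_smul, norm_smul, norm_inv, Real.norm_of_nonneg hpos.le, norm_intVec, ht,
    Int.cast_natCast, inv_mul_cancel₀ hpos.ne']
  norm_num

/-- The FCC reference points lie on `S²(2)`. [folklore] -/
@[simp] theorem norm_fccRef (i : Fin 12) : ‖fccRef i‖ = 2 :=
  norm_refPt two_ne_zero ((by decide : ∀ i : Fin 12, sqNormInt (fccTab i) = 2) i)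

/-- The HCP reference points lie on `S²(2)`. [folklore] -/
@[simp] theorem norm_hcpRef (i : Fin 12) : ‖hcpRef i‖ = 2 :=
  norm_refPt (by norm_num) ((by decide : ∀ i : Fin 12, sqNormInt (hcpTab i) = 18) i)

/-- The FCC base triangle `0, 4, 8` is linearly independent. [folklore] -/
theorem fccRef_base_linearIndependent : LinearIndependent ℝ ![fccRef 0, fccRef 4, fccRef 8] := by
  have d04 : dotInt (fccTab 0) (fccTab 4) = 1 := by decide
  have d08 : dotInt (fccTab 0) (fccTab 8) = 1 := by decide
  have d48 : dotInt (fccTab 4) (fccTab 8) = 1 := by decide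
  have d40 : dotInt (fccTab 4) (fccTab 0) = 1 := by decide
  have d80 : dotInt (fccTab 8) (fccTab 0) = 1 := by decide
  have d84 : dotInt (fccTab 8) (fccTab 4) = 1 := by decide
  refine linearIndependent_of_gram_triangle ?_ ?_
  · intro i; fin_cases i <;> simp <;> norm_num
  · intro i j hij
    fin_cases i <;> fin_cases j <;> simp_all [inner_refPt] <;> norm_num

/-- The HCP base triangle `6, 7, 8` is linearly independent. [folklore] -/
theorem hcpRef_base_linearIndependent : LinearIndependent ℝ ![hcpRef 6, hcpRef 7, hcpRef 8] := by
  have d04 : dotInt (hcpTab 6) (hcpTab 7) = 9 := by decide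
  have d08 : dotInt (hcpTab 6) (hcpTab 8) = 9 := by decide
  have d48 : dotInt (hcpTab 7) (hcpTab 8) = 9 := by decide
  have d40 : dotInt (hcpTab 7) (hcpTab 6) = 9 := by decide
  have d80 : dotInt (hcpTab 8) (hcpTab 6) = 9 := by decide
  have d84 : dotInt (hcpTab 8) (hcpTab 7) = 9 := by decide
  refine linearIndependent_of_gram_triangle ?_ ?_
  · intro i; fin_cases i <;> simp <;> norm_num
  · intro i j hij
    fin_cases i <;> fin_cases j <;> simp_all [inner_refPt] <;> norm_num

/-- Inner products in the FCC reference configuration. [folklore] -/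
theorem inner_fccRef (i j : Fin 12) :
    ⟪fccRef i, fccRef j⟫ = 2 * (dotInt (fccTab i) (fccTab j) : ℝ) := by
  rw [inner_refPt]; norm_num

/-- Inner products in the HCP reference configuration. [folklore] -/
theorem inner_hcpRef (i j : Fin 12) :
    ⟪hcpRef i, hcpRef j⟫ = 2 / 9 * (dotInt (hcpTab i) (hcpTab j) : ℝ) := by
  rw [inner_refPt]; norm_num

/-- **Non-vacuity: the FCC model realizes its own contact pattern** (with `σ = 0`: non-adjacent
model points have inner product `0`, `−2` or `−4`). [folklore] -/
theorem isRealization_fccRef : IsRealization fccAdj 0 fccRef := by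
  have hself : ∀ i : Fin 12, dotInt (fccTab i) (fccTab i) = 2 := by decide
  have hadj : ∀ i j : Fin 12, fccAdj i j → dotInt (fccTab i) (fccTab j) = 1 := by decide
  have hnon : ∀ i j : Fin 12, i ≠ j → ¬fccAdj i j → dotInt (fccTab i) (fccTab j) ≤ 0 := by decide
  refine ⟨by norm_num, fun i => ?_, fun i j h => ?_, fun i j h hn => ?_⟩
  · rw [inner_fccRef, hself]; norm_num
  · rw [inner_fccRef, hadj i j h]; norm_num
  · rw [inner_fccRef]
    have : (dotInt (fccTab i) (fccTab j) : ℝ) ≤ 0 := by exact_mod_cast hnon i j h hn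
    linarith

/-- **Non-vacuity: the HCP model realizes its own contact pattern** (with `σ = 0`). [folklore] -/
theorem isRealization_hcpRef : IsRealization hcpAdj 0 hcpRef := by
  have hself : ∀ i : Fin 12, dotInt (hcpTab i) (hcpTab i) = 18 := by decide
  have hadj : ∀ i j : Fin 12, hcpAdj i j → dotInt (hcpTab i) (hcpTab j) = 9 := by decide
  have hnon : ∀ i j : Fin 12, i ≠ j → ¬hcpAdj i j → dotInt (hcpTab i) (hcpTab j) ≤ 0 := by decide
  refine ⟨by norm_num, fun i => ?_, fun i j h => ?_, fun i j h hn => ?_⟩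
  · rw [inner_hcpRef, hself]; norm_num
  · rw [inner_hcpRef, hadj i j h]; norm_num
  · rw [inner_hcpRef]
    have : (dotInt (hcpTab i) (hcpTab j) : ℝ) ≤ 0 := by exact_mod_cast hnon i j h hn
    linarith

/-! ### Part F. Rigidity of the two patterns -/

/-- **Rigidity of the FCC contact pattern (Hales 2012, Lemma 10, FCC case).** Every realization of
the FCC contact graph on `S²(2)` with separation `σ < 8/9` is the image of the model
configuration `fccRef` under a linear isometry of `ℝ³`. [cite: Hales2012, Lemma 10] -/
theorem fcc_rigid {σ : ℝ} {x : Fin 12 → E3} (hx : IsRealization fccAdj σ x) :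
    ∃ A : E3 →ₗᵢ[ℝ] E3, ∀ i, A (fccRef i) = x i := by
  have sq0 := hx.square (v := 4) (a := 0) (w := 5) (c := 1) (by decide)
  have sq1 := hx.square (v := 6) (a := 2) (w := 7) (c := 3) (by decide)
  have sq2 := hx.square (v := 8) (a := 0) (w := 9) (c := 2) (by decide)
  have sq3 := hx.square (v := 8) (a := 4) (w := 10) (c := 6) (by decide)
  have sq4 := hx.square (v := 9) (a := 5) (w := 11) (c := 7) (by decide)
  have sq5 := hx.square (v := 10) (a := 1) (w := 11) (c := 3) (by decide)
  have vt0 :=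
    hx.vertex (v := 0) (a := 4) (b := 8) (c := 9) (d := 5) (w := 1) (by decide)
  have vt1 :=
    hx.vertex (v := 1) (a := 4) (b := 10) (c := 11) (d := 5) (w := 0) (by decide)
  have vt2 :=
    hx.vertex (v := 2) (a := 6) (b := 8) (c := 9) (d := 7) (w := 3) (by decide)
  have vt3 :=
    hx.vertex (v := 3) (a := 6) (b := 10) (c := 11) (d := 7) (w := 2) (by decide)
  have vt4 :=
    hx.vertex (v := 4) (a := 0) (b := 8) (c := 10) (d := 1) (w := 5) (by decide)
  have vt5 :=
    hx.vertex (v := 5) (a := 0) (b := 9) (c := 11) (d := 1) (w := 4) (by decide)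
  have vt6 :=
    hx.vertex (v := 6) (a := 2) (b := 8) (c := 10) (d := 3) (w := 7) (by decide)
  have vt7 :=
    hx.vertex (v := 7) (a := 2) (b := 9) (c := 11) (d := 3) (w := 6) (by decide)
  have vt8 :=
    hx.vertex (v := 8) (a := 0) (b := 4) (c := 6) (d := 2) (w := 9) (by decide)
  have vt9 :=
    hx.vertex (v := 9) (a := 0) (b := 5) (c := 7) (d := 2) (w := 8) (by decide)
  have vt10 :=
    hx.vertex (v := 10) (a := 1) (b := 4) (c := 6) (d := 3) (w := 11) (by decide)
  have vt11 :=
    hx.vertex (v := 11) (a := 1) (b := 5) (c := 7) (d := 3) (w := 10) (by decide)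
  have e0 : tangentAngle ⟪x 8, x 9⟫ + tangentAngle ⟪x 4, x 5⟫ = 2 * tangentAngle 0 := by
    exact vt0.1
  have e1 : tangentAngle ⟪x 10, x 11⟫ + tangentAngle ⟪x 4, x 5⟫ = 2 * tangentAngle 0 := by
    exact vt1.1
  have e2 : tangentAngle ⟪x 8, x 9⟫ + tangentAngle ⟪x 6, x 7⟫ = 2 * tangentAngle 0 := by
    exact vt2.1
  have e3 : tangentAngle ⟪x 10, x 11⟫ + tangentAngle ⟪x 6, x 7⟫ = 2 * tangentAngle 0 := by
    exact vt3.1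
  have e4 : tangentAngle ⟪x 8, x 10⟫ + tangentAngle ⟪x 0, x 1⟫ = 2 * tangentAngle 0 := by
    exact vt4.1
  have e5 : tangentAngle ⟪x 9, x 11⟫ + tangentAngle ⟪x 0, x 1⟫ = 2 * tangentAngle 0 := by
    exact vt5.1
  have e6 : tangentAngle ⟪x 8, x 10⟫ + tangentAngle ⟪x 2, x 3⟫ = 2 * tangentAngle 0 := by
    exact vt6.1
  have e7 : tangentAngle ⟪x 9, x 11⟫ + tangentAngle ⟪x 2, x 3⟫ = 2 * tangentAngle 0 := by
    exact vt7.1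
  have e8 : tangentAngle ⟪x 4, x 6⟫ + tangentAngle ⟪x 0, x 2⟫ = 2 * tangentAngle 0 := by
    exact vt8.1
  have e9 : tangentAngle ⟪x 5, x 7⟫ + tangentAngle ⟪x 0, x 2⟫ = 2 * tangentAngle 0 := by
    exact vt9.1
  have e10 : tangentAngle ⟪x 4, x 6⟫ + tangentAngle ⟪x 1, x 3⟫ = 2 * tangentAngle 0 := by
    exact vt10.1
  have e11 : tangentAngle ⟪x 5, x 7⟫ + tangentAngle ⟪x 1, x 3⟫ = 2 * tangentAngle 0 := by
    exact vt11.1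
  have Esq0 : tangentAngle ⟪x 0, x 1⟫ + tangentAngle ⟪x 4, x 5⟫ = 2 * tangentAngle 0 := by
    linarith [sq0.1, sq1.1, sq2.1, sq3.1, sq4.1, sq5.1, e0, e1, e2, e3, e4, e5,
      e6, e7, e8, e9, e10, e11]
  obtain ⟨z_0_1, z_4_5⟩ := sq0.2 Esq0
  have Esq1 : tangentAngle ⟪x 2, x 3⟫ + tangentAngle ⟪x 6, x 7⟫ = 2 * tangentAngle 0 := by
    linarith [sq0.1, sq1.1, sq2.1, sq3.1, sq4.1, sq5.1, e0, e1, e2, e3, e4, e5,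
      e6, e7, e8, e9, e10, e11]
  obtain ⟨z_2_3, z_6_7⟩ := sq1.2 Esq1
  have Esq2 : tangentAngle ⟪x 0, x 2⟫ + tangentAngle ⟪x 8, x 9⟫ = 2 * tangentAngle 0 := by
    linarith [sq0.1, sq1.1, sq2.1, sq3.1, sq4.1, sq5.1, e0, e1, e2, e3, e4, e5,
      e6, e7, e8, e9, e10, e11]
  obtain ⟨z_0_2, z_8_9⟩ := sq2.2 Esq2
  have Esq3 : tangentAngle ⟪x 4, x 6⟫ + tangentAngle ⟪x 8, x 10⟫ = 2 * tangentAngle 0 := by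
    linarith [sq0.1, sq1.1, sq2.1, sq3.1, sq4.1, sq5.1, e0, e1, e2, e3, e4, e5,
      e6, e7, e8, e9, e10, e11]
  obtain ⟨z_4_6, z_8_10⟩ := sq3.2 Esq3
  have Esq4 : tangentAngle ⟪x 5, x 7⟫ + tangentAngle ⟪x 9, x 11⟫ = 2 * tangentAngle 0 := by
    linarith [sq0.1, sq1.1, sq2.1, sq3.1, sq4.1, sq5.1, e0, e1, e2, e3, e4, e5,
      e6, e7, e8, e9, e10, e11]
  obtain ⟨z_5_7, z_9_11⟩ := sq4.2 Esq4
  have Esq5 : tangentAngle ⟪x 1, x 3⟫ + tangentAngle ⟪x 10, x 11⟫ = 2 * tangentAngle 0 := by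
    linarith [sq0.1, sq1.1, sq2.1, sq3.1, sq4.1, sq5.1, e0, e1, e2, e3, e4, e5,
      e6, e7, e8, e9, e10, e11]
  obtain ⟨z_1_3, z_10_11⟩ := sq5.2 Esq5
  obtain ⟨r0a, r0b⟩ := vt0.2 z_8_9 z_4_5
  obtain ⟨r4a, r4b⟩ := vt4.2 z_8_10 z_0_1
  obtain ⟨r5a, r5b⟩ := vt5.2 z_9_11 z_0_1
  obtain ⟨r8a, r8b⟩ := vt8.2 z_4_6 z_0_2
  obtain ⟨r9a, r9b⟩ := vt9.2 z_5_7 z_0_2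
  obtain ⟨r10a, r10b⟩ := vt10.2 z_4_6 z_1_3
  -- the base triangle `0, 4, 8` and the linear isometry
  have g_0_4 : ⟪x 0, x 4⟫ = 2 := hx.inner_adj (by decide : fccAdj 0 4)
  have g_0_8 : ⟪x 0, x 8⟫ = 2 := hx.inner_adj (by decide : fccAdj 0 8)
  have g_4_0 : ⟪x 4, x 0⟫ = 2 := hx.inner_adj (by decide : fccAdj 4 0)
  have g_4_8 : ⟪x 4, x 8⟫ = 2 := hx.inner_adj (by decide : fccAdj 4 8)
  have g_8_0 : ⟪x 8, x 0⟫ = 2 := hx.inner_adj (by decide : fccAdj 8 0)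
  have g_8_4 : ⟪x 8, x 4⟫ = 2 := hx.inner_adj (by decide : fccAdj 8 4)
  have d_0_4 : dotInt (fccTab 0) (fccTab 4) = 1 := by decide
  have d_0_8 : dotInt (fccTab 0) (fccTab 8) = 1 := by decide
  have d_4_0 : dotInt (fccTab 4) (fccTab 0) = 1 := by decide
  have d_4_8 : dotInt (fccTab 4) (fccTab 8) = 1 := by decide
  have d_8_0 : dotInt (fccTab 8) (fccTab 0) = 1 := by decide
  have d_8_4 : dotInt (fccTab 8) (fccTab 4) = 1 := by decide
  obtain ⟨A, hA⟩ := exists_linearIsometry_of_inner_eq fccRef_base_linearIndependent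
    (q := ![x 0, x 4, x 8]) (by
      intro i j
      fin_cases i <;> fin_cases j <;>
        simp [inner_fccRef, hx.norm_eq, norm_fccRef, g_0_4, g_0_8, g_4_0, g_4_8, g_8_0, g_8_4,
          d_0_4, d_0_8, d_4_0, d_4_8, d_8_0, d_8_4])
  have hA0 : A (fccRef 0) = x 0 := by simpa using hA 0
  have hA4 : A (fccRef 4) = x 4 := by simpa using hA 1
  have hA8 : A (fccRef 8) = x 8 := by simpa using hA 2
  have hA9 : A (fccRef 9) = x 9 := by
    have hP : fccRef 4 + fccRef 9 = fccRef 0 := by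
      have hI : fccTab 4 + fccTab 9 = fccTab 0 := by decide
      simpa only [refPt_add] using congrArg (refPt 2) hI
    rw [show fccRef 9 = fccRef 0 - fccRef 4 by rw [← hP]; abel, map_sub, hA0,
      hA4, show x 9 = x 0 - x 4 by rw [← r0a]; abel]
  have hA5 : A (fccRef 5) = x 5 := by
    have hP : fccRef 8 + fccRef 5 = fccRef 0 := by
      have hI : fccTab 8 + fccTab 5 = fccTab 0 := by decide
      simpa only [refPt_add] using congrArg (refPt 2) hI
    rw [show fccRef 5 = fccRef 0 - fccRef 8 by rw [← hP]; abel, map_sub, hA0,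
      hA8, show x 5 = x 0 - x 8 by rw [← r0b]; abel]
  have hA10 : A (fccRef 10) = x 10 := by
    have hP : fccRef 0 + fccRef 10 = fccRef 4 := by
      have hI : fccTab 0 + fccTab 10 = fccTab 4 := by decide
      simpa only [refPt_add] using congrArg (refPt 2) hI
    rw [show fccRef 10 = fccRef 4 - fccRef 0 by rw [← hP]; abel, map_sub, hA4,
      hA0, show x 10 = x 4 - x 0 by rw [← r4a]; abel]
  have hA1 : A (fccRef 1) = x 1 := by
    have hP : fccRef 8 + fccRef 1 = fccRef 4 := by
      have hI : fccTab 8 + fccTab 1 = fccTab 4 := by decide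
      simpa only [refPt_add] using congrArg (refPt 2) hI
    rw [show fccRef 1 = fccRef 4 - fccRef 8 by rw [← hP]; abel, map_sub, hA4,
      hA8, show x 1 = x 4 - x 8 by rw [← r4b]; abel]
  have hA11 : A (fccRef 11) = x 11 := by
    have hP : fccRef 0 + fccRef 11 = fccRef 5 := by
      have hI : fccTab 0 + fccTab 11 = fccTab 5 := by decide
      simpa only [refPt_add] using congrArg (refPt 2) hI
    rw [show fccRef 11 = fccRef 5 - fccRef 0 by rw [← hP]; abel, map_sub, hA5,
      hA0, show x 11 = x 5 - x 0 by rw [← r5a]; abel]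
  have hA6 : A (fccRef 6) = x 6 := by
    have hP : fccRef 0 + fccRef 6 = fccRef 8 := by
      have hI : fccTab 0 + fccTab 6 = fccTab 8 := by decide
      simpa only [refPt_add] using congrArg (refPt 2) hI
    rw [show fccRef 6 = fccRef 8 - fccRef 0 by rw [← hP]; abel, map_sub, hA8,
      hA0, show x 6 = x 8 - x 0 by rw [← r8a]; abel]
  have hA2 : A (fccRef 2) = x 2 := by
    have hP : fccRef 4 + fccRef 2 = fccRef 8 := by
      have hI : fccTab 4 + fccTab 2 = fccTab 8 := by decide
      simpa only [refPt_add] using congrArg (refPt 2) hI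
    rw [show fccRef 2 = fccRef 8 - fccRef 4 by rw [← hP]; abel, map_sub, hA8,
      hA4, show x 2 = x 8 - x 4 by rw [← r8b]; abel]
  have hA7 : A (fccRef 7) = x 7 := by
    have hP : fccRef 0 + fccRef 7 = fccRef 9 := by
      have hI : fccTab 0 + fccTab 7 = fccTab 9 := by decide
      simpa only [refPt_add] using congrArg (refPt 2) hI
    rw [show fccRef 7 = fccRef 9 - fccRef 0 by rw [← hP]; abel, map_sub, hA9,
      hA0, show x 7 = x 9 - x 0 by rw [← r9a]; abel]
  have hA3 : A (fccRef 3) = x 3 := by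
    have hP : fccRef 4 + fccRef 3 = fccRef 10 := by
      have hI : fccTab 4 + fccTab 3 = fccTab 10 := by decide
      simpa only [refPt_add] using congrArg (refPt 2) hI
    rw [show fccRef 3 = fccRef 10 - fccRef 4 by rw [← hP]; abel, map_sub, hA10,
      hA4, show x 3 = x 10 - x 4 by rw [← r10b]; abel]
  refine ⟨A, fun i => ?_⟩
  fin_cases i
  · exact hA0
  · exact hA1
  · exact hA2
  · exact hA3
  · exact hA4
  · exact hA5
  · exact hA6
  · exact hA7
  · exact hA8
  · exact hA9
  · exact hA10
  · exact hA11

/-- **Rigidity of the HCP contact pattern (Hales 2012, Lemma 10, HCP case).** Every realization of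
the HCP contact graph on `S²(2)` with separation `σ < 8/9` is the image of the model
configuration `hcpRef` under a linear isometry of `ℝ³`. [cite: Hales2012, Lemma 10] -/
theorem hcp_rigid {σ : ℝ} {x : Fin 12 → E3} (hx : IsRealization hcpAdj σ x) :
    ∃ A : E3 →ₗᵢ[ℝ] E3, ∀ i, A (hcpRef i) = x i := by
  have sq0 := hx.square (v := 1) (a := 4) (w := 6) (c := 8) (by decide)
  have sq1 := hx.square (v := 2) (a := 0) (w := 7) (c := 6) (by decide)
  have sq2 := hx.square (v := 2) (a := 0) (w := 10) (c := 9) (by decide)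
  have sq3 := hx.square (v := 4) (a := 1) (w := 11) (c := 9) (by decide)
  have sq4 := hx.square (v := 5) (a := 3) (w := 8) (c := 7) (by decide)
  have sq5 := hx.square (v := 5) (a := 3) (w := 11) (c := 10) (by decide)
  have vt0 :=
    hx.vertex' (h := 0) (e := 5) (u := 7) (l := 10) (k := 2) (by decide)
  have vt1 :=
    hx.vertex' (h := 1) (e := 3) (u := 8) (l := 11) (k := 4) (by decide)
  have vt2 :=
    hx.vertex' (h := 2) (e := 4) (u := 6) (l := 9) (k := 0) (by decide)
  have vt3 :=
    hx.vertex' (h := 3) (e := 1) (u := 8) (l := 11) (k := 5) (by decide)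
  have vt4 :=
    hx.vertex' (h := 4) (e := 2) (u := 6) (l := 9) (k := 1) (by decide)
  have vt5 :=
    hx.vertex' (h := 5) (e := 0) (u := 7) (l := 10) (k := 3) (by decide)
  have vt6 :=
    hx.vertex (v := 6) (a := 2) (b := 4) (c := 8) (d := 7) (w := 0) (by decide)
  have vt7 :=
    hx.vertex (v := 7) (a := 0) (b := 5) (c := 8) (d := 6) (w := 2) (by decide)
  have vt8 :=
    hx.vertex (v := 8) (a := 1) (b := 3) (c := 7) (d := 6) (w := 4) (by decide)
  have vt9 :=
    hx.vertex (v := 9) (a := 2) (b := 4) (c := 11) (d := 10) (w := 0) (by decide)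
  have vt10 :=
    hx.vertex (v := 10) (a := 0) (b := 5) (c := 11) (d := 9) (w := 2) (by decide)
  have vt11 :=
    hx.vertex (v := 11) (a := 1) (b := 3) (c := 10) (d := 9) (w := 4) (by decide)
  have e0 : tangentAngle ⟪x 2, x 7⟫ + tangentAngle ⟪x 2, x 10⟫ = 2 * tangentAngle 0 := by
    exact vt0.1
  have e1 : tangentAngle ⟪x 4, x 8⟫ + tangentAngle ⟪x 4, x 11⟫ = 2 * tangentAngle 0 := by
    exact vt1.1
  have e2 : tangentAngle ⟪x 0, x 6⟫ + tangentAngle ⟪x 0, x 9⟫ = 2 * tangentAngle 0 := by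
    exact vt2.1
  have e3 : tangentAngle ⟪x 5, x 8⟫ + tangentAngle ⟪x 5, x 11⟫ = 2 * tangentAngle 0 := by
    exact vt3.1
  have e4 : tangentAngle ⟪x 1, x 6⟫ + tangentAngle ⟪x 1, x 9⟫ = 2 * tangentAngle 0 := by
    exact vt4.1
  have e5 : tangentAngle ⟪x 3, x 7⟫ + tangentAngle ⟪x 3, x 10⟫ = 2 * tangentAngle 0 := by
    exact vt5.1
  have e6 : tangentAngle ⟪x 4, x 8⟫ + tangentAngle ⟪x 2, x 7⟫ = 2 * tangentAngle 0 := by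
    exact vt6.1
  have e7 : tangentAngle ⟪x 5, x 8⟫ + tangentAngle ⟪x 0, x 6⟫ = 2 * tangentAngle 0 := by
    exact vt7.1
  have e8 : tangentAngle ⟪x 3, x 7⟫ + tangentAngle ⟪x 1, x 6⟫ = 2 * tangentAngle 0 := by
    exact vt8.1
  have e9 : tangentAngle ⟪x 4, x 11⟫ + tangentAngle ⟪x 2, x 10⟫ = 2 * tangentAngle 0 := by
    exact vt9.1
  have e10 : tangentAngle ⟪x 5, x 11⟫ + tangentAngle ⟪x 0, x 9⟫ = 2 * tangentAngle 0 := by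
    exact vt10.1
  have e11 : tangentAngle ⟪x 3, x 10⟫ + tangentAngle ⟪x 1, x 9⟫ = 2 * tangentAngle 0 := by
    exact vt11.1
  have Esq0 : tangentAngle ⟪x 4, x 8⟫ + tangentAngle ⟪x 1, x 6⟫ = 2 * tangentAngle 0 := by
    linarith [sq0.1, sq1.1, sq2.1, sq3.1, sq4.1, sq5.1, e0, e1, e2, e3, e4, e5,
      e6, e7, e8, e9, e10, e11]
  obtain ⟨z_4_8, z_1_6⟩ := sq0.2 Esq0
  have Esq1 : tangentAngle ⟪x 0, x 6⟫ + tangentAngle ⟪x 2, x 7⟫ = 2 * tangentAngle 0 := by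
    linarith [sq0.1, sq1.1, sq2.1, sq3.1, sq4.1, sq5.1, e0, e1, e2, e3, e4, e5,
      e6, e7, e8, e9, e10, e11]
  obtain ⟨z_0_6, z_2_7⟩ := sq1.2 Esq1
  have Esq2 : tangentAngle ⟪x 0, x 9⟫ + tangentAngle ⟪x 2, x 10⟫ = 2 * tangentAngle 0 := by
    linarith [sq0.1, sq1.1, sq2.1, sq3.1, sq4.1, sq5.1, e0, e1, e2, e3, e4, e5,
      e6, e7, e8, e9, e10, e11]
  obtain ⟨z_0_9, z_2_10⟩ := sq2.2 Esq2
  have Esq3 : tangentAngle ⟪x 1, x 9⟫ + tangentAngle ⟪x 4, x 11⟫ = 2 * tangentAngle 0 := by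
    linarith [sq0.1, sq1.1, sq2.1, sq3.1, sq4.1, sq5.1, e0, e1, e2, e3, e4, e5,
      e6, e7, e8, e9, e10, e11]
  obtain ⟨z_1_9, z_4_11⟩ := sq3.2 Esq3
  have Esq4 : tangentAngle ⟪x 3, x 7⟫ + tangentAngle ⟪x 5, x 8⟫ = 2 * tangentAngle 0 := by
    linarith [sq0.1, sq1.1, sq2.1, sq3.1, sq4.1, sq5.1, e0, e1, e2, e3, e4, e5,
      e6, e7, e8, e9, e10, e11]
  obtain ⟨z_3_7, z_5_8⟩ := sq4.2 Esq4
  have Esq5 : tangentAngle ⟪x 3, x 10⟫ + tangentAngle ⟪x 5, x 11⟫ = 2 * tangentAngle 0 := by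
    linarith [sq0.1, sq1.1, sq2.1, sq3.1, sq4.1, sq5.1, e0, e1, e2, e3, e4, e5,
      e6, e7, e8, e9, e10, e11]
  obtain ⟨z_3_10, z_5_11⟩ := sq5.2 Esq5
  have r0l := vt0.2.1
  have r0k := vt0.2.2 z_2_7 z_2_10
  have r1l := vt1.2.1
  have r1k := vt1.2.2 z_4_8 z_4_11
  have r2l := vt2.2.1
  have r2k := vt2.2.2 z_0_6 z_0_9
  obtain ⟨r6a, r6b⟩ := vt6.2 z_4_8 z_2_7
  obtain ⟨r7a, r7b⟩ := vt7.2 z_5_8 z_0_6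
  obtain ⟨r8a, r8b⟩ := vt8.2 z_3_7 z_1_6
  -- the base triangle `6, 7, 8` and the linear isometry
  have g_6_7 : ⟪x 6, x 7⟫ = 2 := hx.inner_adj (by decide : hcpAdj 6 7)
  have g_6_8 : ⟪x 6, x 8⟫ = 2 := hx.inner_adj (by decide : hcpAdj 6 8)
  have g_7_6 : ⟪x 7, x 6⟫ = 2 := hx.inner_adj (by decide : hcpAdj 7 6)
  have g_7_8 : ⟪x 7, x 8⟫ = 2 := hx.inner_adj (by decide : hcpAdj 7 8)
  have g_8_6 : ⟪x 8, x 6⟫ = 2 := hx.inner_adj (by decide : hcpAdj 8 6)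
  have g_8_7 : ⟪x 8, x 7⟫ = 2 := hx.inner_adj (by decide : hcpAdj 8 7)
  have d_6_7 : dotInt (hcpTab 6) (hcpTab 7) = 9 := by decide
  have d_6_8 : dotInt (hcpTab 6) (hcpTab 8) = 9 := by decide
  have d_7_6 : dotInt (hcpTab 7) (hcpTab 6) = 9 := by decide
  have d_7_8 : dotInt (hcpTab 7) (hcpTab 8) = 9 := by decide
  have d_8_6 : dotInt (hcpTab 8) (hcpTab 6) = 9 := by decide
  have d_8_7 : dotInt (hcpTab 8) (hcpTab 7) = 9 := by decide
  obtain ⟨A, hA⟩ := exists_linearIsometry_of_inner_eq hcpRef_base_linearIndependent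
    (q := ![x 6, x 7, x 8]) (by
      intro i j
      fin_cases i <;> fin_cases j <;>
        simp [inner_hcpRef, hx.norm_eq, norm_hcpRef, g_6_7, g_6_8, g_7_6, g_7_8, g_8_6, g_8_7,
          d_6_7, d_6_8, d_7_6, d_7_8, d_8_6, d_8_7])
  have hA6 : A (hcpRef 6) = x 6 := by simpa using hA 0
  have hA7 : A (hcpRef 7) = x 7 := by simpa using hA 1
  have hA8 : A (hcpRef 8) = x 8 := by simpa using hA 2
  have hA2 : A (hcpRef 2) = x 2 := by
    have hP : hcpRef 2 + hcpRef 8 = hcpRef 6 := by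
      have hI : hcpTab 2 + hcpTab 8 = hcpTab 6 := by decide
      simpa only [refPt_add] using congrArg (refPt 18) hI
    rw [show hcpRef 2 = hcpRef 6 - hcpRef 8 by rw [← hP]; abel, map_sub, hA6,
      hA8, show x 2 = x 6 - x 8 by rw [← r6a]; abel]
  have hA4 : A (hcpRef 4) = x 4 := by
    have hP : hcpRef 4 + hcpRef 7 = hcpRef 6 := by
      have hI : hcpTab 4 + hcpTab 7 = hcpTab 6 := by decide
      simpa only [refPt_add] using congrArg (refPt 18) hI
    rw [show hcpRef 4 = hcpRef 6 - hcpRef 7 by rw [← hP]; abel, map_sub, hA6,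
      hA7, show x 4 = x 6 - x 7 by rw [← r6b]; abel]
  have hA0 : A (hcpRef 0) = x 0 := by
    have hP : hcpRef 0 + hcpRef 8 = hcpRef 7 := by
      have hI : hcpTab 0 + hcpTab 8 = hcpTab 7 := by decide
      simpa only [refPt_add] using congrArg (refPt 18) hI
    rw [show hcpRef 0 = hcpRef 7 - hcpRef 8 by rw [← hP]; abel, map_sub, hA7,
      hA8, show x 0 = x 7 - x 8 by rw [← r7a]; abel]
  have hA5 : A (hcpRef 5) = x 5 := by
    have hP : hcpRef 5 + hcpRef 6 = hcpRef 7 := by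
      have hI : hcpTab 5 + hcpTab 6 = hcpTab 7 := by decide
      simpa only [refPt_add] using congrArg (refPt 18) hI
    rw [show hcpRef 5 = hcpRef 7 - hcpRef 6 by rw [← hP]; abel, map_sub, hA7,
      hA6, show x 5 = x 7 - x 6 by rw [← r7b]; abel]
  have hA1 : A (hcpRef 1) = x 1 := by
    have hP : hcpRef 1 + hcpRef 7 = hcpRef 8 := by
      have hI : hcpTab 1 + hcpTab 7 = hcpTab 8 := by decide
      simpa only [refPt_add] using congrArg (refPt 18) hI
    rw [show hcpRef 1 = hcpRef 8 - hcpRef 7 by rw [← hP]; abel, map_sub, hA8,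
      hA7, show x 1 = x 8 - x 7 by rw [← r8a]; abel]
  have hA3 : A (hcpRef 3) = x 3 := by
    have hP : hcpRef 3 + hcpRef 6 = hcpRef 8 := by
      have hI : hcpTab 3 + hcpTab 6 = hcpTab 8 := by decide
      simpa only [refPt_add] using congrArg (refPt 18) hI
    rw [show hcpRef 3 = hcpRef 8 - hcpRef 6 by rw [← hP]; abel, map_sub, hA8,
      hA6, show x 3 = x 8 - x 6 by rw [← r8b]; abel]
  have hA10 : A (hcpRef 10) = x 10 := by
    have hP : (3 : ℝ) • hcpRef 7 + (3 : ℝ) • hcpRef 10 =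
        (2 : ℝ) • hcpRef 0 + (2 : ℝ) • hcpRef 5 := by
      have hI : (3 : ℤ) • hcpTab 7 + (3 : ℤ) • hcpTab 10 =
          (2 : ℤ) • hcpTab 0 + (2 : ℤ) • hcpTab 5 := by decide
      have hI' := congrArg (refPt 18) hI
      simp only [refPt_add, refPt_intSmul] at hI'
      exact_mod_cast hI'
    have h3 : (3 : ℝ) • hcpRef 10 =
        (2 : ℝ) • hcpRef 0 + (2 : ℝ) • hcpRef 5 - (3 : ℝ) • hcpRef 7 := by
      rw [← hP]; abel
    have h3x : (3 : ℝ) • x 10 = (2 : ℝ) • x 0 + (2 : ℝ) • x 5 - (3 : ℝ) • x 7 := by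
      rw [← r0l]; abel
    refine smul_right_injective E3 (by norm_num : (3 : ℝ) ≠ 0) ?_
    change (3 : ℝ) • A (hcpRef 10) = (3 : ℝ) • x 10
    rw [← map_smul, h3, map_sub, map_add, map_smul, map_smul, map_smul, hA0, hA5, hA7,
      h3x]
  have hA11 : A (hcpRef 11) = x 11 := by
    have hP : (3 : ℝ) • hcpRef 8 + (3 : ℝ) • hcpRef 11 =
        (2 : ℝ) • hcpRef 1 + (2 : ℝ) • hcpRef 3 := by
      have hI : (3 : ℤ) • hcpTab 8 + (3 : ℤ) • hcpTab 11 =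
          (2 : ℤ) • hcpTab 1 + (2 : ℤ) • hcpTab 3 := by decide
      have hI' := congrArg (refPt 18) hI
      simp only [refPt_add, refPt_intSmul] at hI'
      exact_mod_cast hI'
    have h3 : (3 : ℝ) • hcpRef 11 =
        (2 : ℝ) • hcpRef 1 + (2 : ℝ) • hcpRef 3 - (3 : ℝ) • hcpRef 8 := by
      rw [← hP]; abel
    have h3x : (3 : ℝ) • x 11 = (2 : ℝ) • x 1 + (2 : ℝ) • x 3 - (3 : ℝ) • x 8 := by
      rw [← r1l]; abel
    refine smul_right_injective E3 (by norm_num : (3 : ℝ) ≠ 0) ?_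
    change (3 : ℝ) • A (hcpRef 11) = (3 : ℝ) • x 11
    rw [← map_smul, h3, map_sub, map_add, map_smul, map_smul, map_smul, hA1, hA3, hA8,
      h3x]
  have hA9 : A (hcpRef 9) = x 9 := by
    have hP : (3 : ℝ) • hcpRef 6 + (3 : ℝ) • hcpRef 9 =
        (2 : ℝ) • hcpRef 2 + (2 : ℝ) • hcpRef 4 := by
      have hI : (3 : ℤ) • hcpTab 6 + (3 : ℤ) • hcpTab 9 =
          (2 : ℤ) • hcpTab 2 + (2 : ℤ) • hcpTab 4 := by decide
      have hI' := congrArg (refPt 18) hI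
      simp only [refPt_add, refPt_intSmul] at hI'
      exact_mod_cast hI'
    have h3 : (3 : ℝ) • hcpRef 9 =
        (2 : ℝ) • hcpRef 2 + (2 : ℝ) • hcpRef 4 - (3 : ℝ) • hcpRef 6 := by
      rw [← hP]; abel
    have h3x : (3 : ℝ) • x 9 = (2 : ℝ) • x 2 + (2 : ℝ) • x 4 - (3 : ℝ) • x 6 := by
      rw [← r2l]; abel
    refine smul_right_injective E3 (by norm_num : (3 : ℝ) ≠ 0) ?_
    change (3 : ℝ) • A (hcpRef 9) = (3 : ℝ) • x 9
    rw [← map_smul, h3, map_sub, map_add, map_smul, map_smul, map_smul, hA2, hA4, hA6,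
      h3x]
  refine ⟨A, fun i => ?_⟩
  fin_cases i
  · exact hA0
  · exact hA1
  · exact hA2
  · exact hA3
  · exact hA4
  · exact hA5
  · exact hA6
  · exact hA7
  · exact hA8
  · exact hA9
  · exact hA10
  · exact hA11

/-! ### Part G. Lemma 10: kissing configurations with FCC/HCP contact graph are congruent to the
model -/

/-- `fccInt` is enumerated by `fccTab`. [folklore] -/
theorem fccInt_eq_image : fccInt = Finset.univ.image fccTab := by decide

/-- `hcpInt` is enumerated by `hcpTab`. [folklore] -/
theorem hcpInt_eq_image : hcpInt = Finset.univ.image hcpTab := by decide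

/-- `fccTab` is injective. [folklore] -/
theorem fccTab_injective : Function.Injective fccTab := by decide

/-- `hcpTab` is injective. [folklore] -/
theorem hcpTab_injective : Function.Injective hcpTab := by decide

/-- The FCC configuration `2 · fccKissingPattern` is the range of `fccRef`. [folklore] -/
theorem two_smul_image_fcc_eq_range :
    (fun p => (2 : ℝ) • p) '' (fccKissingPattern : Set E3) = Set.range fccRef := by
  rw [fccKissingPattern, scaledPattern, fccInt_eq_image, Finset.image_image, Finset.coe_image,
    Finset.coe_univ, Set.image_univ, ← Set.range_comp]
  rfl

/-- The HCP configuration `2 · hcpKissingPattern` is the range of `hcpRef`. [folklore] -/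
theorem two_smul_image_hcp_eq_range :
    (fun p => (2 : ℝ) • p) '' (hcpKissingPattern : Set E3) = Set.range hcpRef := by
  rw [hcpKissingPattern, scaledPattern, hcpInt_eq_image, Finset.image_image, Finset.coe_image,
    Finset.coe_univ, Set.image_univ, ← Set.range_comp]
  rfl

/-- `refPt N` is injective for `N ≠ 0`. [folklore] -/
theorem refPt_injective {N : ℕ} (hN : N ≠ 0) : Function.Injective (refPt N) :=
  (smul_right_injective E3 (two_ne_zero (α := ℝ))).comp (scaledPattern_map_injective hN)

/-- Inner product from distance on `S²(2)`: `⟪x, y⟫ = (8 − dist(x,y)²)/2`. [folklore] -/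
theorem inner_eq_of_norm_eq_two {x y : E3} (hx : ‖x‖ = 2) (hy : ‖y‖ = 2) :
    ⟪x, y⟫ = (8 - dist x y ^ 2) / 2 := by
  rw [dist_eq_norm, norm_sub_sq_real, hx, hy]
  ring

/-- **Lemma 10 for an enumerated model.** Let `S ∈ 𝒱` be a kissing configuration whose contact
graph is isomorphic to that of the model `2P = {refPt N (tab i)}`; if every realization of the
model's contact relation is congruent to the model (`rigid`), then `S` is arranged in the pattern
`P`. [cite: Hales2012, Lemma 10] -/
theorem isArrangedIn_of_contactGraph_iso {S : Set E3} (hS : IsKissingConfig S) {P : Finset E3}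
    {N : ℕ} (hN : N ≠ 0) {tab : Fin 12 → Fin 3 → ℤ} (htab : Function.Injective tab)
    (hP : (fun p => (2 : ℝ) • p) '' (P : Set E3) = Set.range fun i => refPt N (tab i))
    (rigid : ∀ {σ : ℝ} {x : Fin 12 → E3},
      IsRealization (fun i j => sqNormInt (tab i - tab j) = N) σ x →
        ∃ A : E3 →ₗᵢ[ℝ] E3, ∀ i, A (refPt N (tab i)) = x i)
    (e : contactGraph S ≃g contactGraph ((fun p => (2 : ℝ) • p) '' (P : Set E3))) :
    IsArrangedIn S P := by
  set R : Set E3 := (fun p => (2 : ℝ) • p) '' (P : Set E3) with hR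
  set ref : Fin 12 → E3 := fun i => refPt N (tab i) with href
  have memR : ∀ i, ref i ∈ R := fun i => by rw [hP]; exact Set.mem_range_self i
  set r : Fin 12 → R := fun i => ⟨ref i, memR i⟩ with hr
  have hrsurj : Function.Surjective r := by
    rintro ⟨p, hp⟩
    rw [hP] at hp
    obtain ⟨i, rfl⟩ := hp
    exact ⟨i, rfl⟩
  have hrinj : Function.Injective r := fun i j hij =>
    htab (refPt_injective hN (by simpa [hr] using congrArg Subtype.val hij))
  set y : Fin 12 → S := fun i => e.symm (r i) with hy
  set x : Fin 12 → E3 := fun i => (y i : E3) with hxdef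
  have hxmem : ∀ i, x i ∈ S := fun i => (y i).2
  have hnorm : ∀ i, ‖x i‖ = 2 := fun i => hS.norm_eq (hxmem i)
  have hadj : ∀ i j, dist (x i) (x j) = 2 ↔ sqNormInt (tab i - tab j) = N := fun i j => by
    rw [← dist_refPt_eq_two_iff hN]
    change (contactGraph S).Adj (y i) (y j) ↔ (contactGraph R).Adj (r i) (r j)
    rw [hy]
    exact e.symm.map_adj_iff
  have hxinj : Function.Injective x := fun i j hij =>
    hrinj (e.symm.injective (Subtype.ext hij))
  -- `x` is a realization with `σ = 4 − 2h₀² = 0.8248`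
  have hreal :
      IsRealization (fun i j => sqNormInt (tab i - tab j) = N) (4 - 2 * hales_h0 ^ 2) x := by
    refine ⟨by rw [hales_h0_eq]; norm_num, fun i => ?_, fun i j hij => ?_, fun i j hij hn => ?_⟩
    · rw [real_inner_self_eq_norm_sq, hnorm]; norm_num
    · rw [inner_eq_of_norm_eq_two (hnorm i) (hnorm j), (hadj i j).2 hij]; norm_num
    · have hne : x i ≠ x j := fun h => hij (hxinj h)
      have h2 : dist (x i) (x j) ≠ 2 := fun h => hn ((hadj i j).1 h)
      have hle := hS.le_dist_of_ne (hxmem i) (hxmem j) hne h2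
      have h0 : 0 ≤ 2 * hales_h0 := by rw [hales_h0_eq]; norm_num
      rw [inner_eq_of_norm_eq_two (hnorm i) (hnorm j)]
      nlinarith [mul_le_mul hle hle h0 dist_nonneg]
  obtain ⟨A, hA⟩ := rigid hreal
  refine ⟨A, ?_⟩
  -- `S = range x = A '' R = {2 A p : p ∈ P}`
  have h1 : (fun p => (2 : ℝ) • A p) '' (P : Set E3) = A '' R := by
    rw [hR, Set.image_image]
    simp only [map_smul]
  have h2 : A '' R = Set.range x := by
    rw [hP, ← Set.range_comp]
    exact congrArg Set.range (funext fun i => hA i)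
  have h3 : Set.range x = S := by
    have hysurj : Function.Surjective y := e.symm.surjective.comp hrsurj
    rw [hxdef, Set.range_comp' Subtype.val y, hysurj.range_eq, Set.image_univ,
      Subtype.range_coe]
  rw [h1, h2, h3]

/-- **Hales 2012, Lemma 10 (FCC case), proved**: a kissing configuration `S ∈ 𝒱` whose contact
graph is isomorphic to that of the FCC configuration is congruent to it in `S²(2)`.
[cite: Hales2012, Lemma 10] -/
theorem isArrangedIn_fcc_of_contactGraph_iso {S : Set E3} (hS : IsKissingConfig S)
    (e : contactGraph S ≃g contactGraph ((fun p => (2 : ℝ) • p) '' (fccKissingPattern : Set E3))) :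
    IsArrangedIn S fccKissingPattern :=
  isArrangedIn_of_contactGraph_iso hS two_ne_zero fccTab_injective two_smul_image_fcc_eq_range
    (fun hx => fcc_rigid hx) e

/-- **Hales 2012, Lemma 10 (HCP case), proved**: a kissing configuration `S ∈ 𝒱` whose contact
graph is isomorphic to that of the HCP configuration is congruent to it in `S²(2)`.
[cite: Hales2012, Lemma 10] -/
theorem isArrangedIn_hcp_of_contactGraph_iso {S : Set E3} (hS : IsKissingConfig S)
    (e : contactGraph S ≃g contactGraph ((fun p => (2 : ℝ) • p) '' (hcpKissingPattern : Set E3))) :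
    IsArrangedIn S hcpKissingPattern :=
  isArrangedIn_of_contactGraph_iso hS (by norm_num) hcpTab_injective two_smul_image_hcp_eq_range
    (fun hx => hcp_rigid hx) e

/-- **Hales 2012, Lemma 10 (rigidity), proved: Theorem 3 + Lemma 9 imply the classification of
kissing configurations.** `Hales2012_contactGraphFccOrHcp → Hales2012_kissingConfigCongruent`:
the named fact "Lemmas 9–10 as chained on p. 14" reduces to the graph-level form of Theorem 3 +
Lemma 9 (the computer-assisted part) — Lemma 10 itself is now a theorem. [cite: Hales2012,
Lemma 10 and proof of Theorem 1 (p. 14)] -/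
theorem kissingConfigCongruent_of_contactGraphFccOrHcp (h : Hales2012_contactGraphFccOrHcp) :
    Hales2012_kissingConfigCongruent := fun S hS =>
  (h S hS).imp (fun ⟨e⟩ => isArrangedIn_fcc_of_contactGraph_iso hS e)
    fun ⟨e⟩ => isArrangedIn_hcp_of_contactGraph_iso hS e

/-- Conversely (elementary): a set arranged in the pattern `P` has contact graph isomorphic to
that of `2P` (a linear isometry preserves distances). [folklore] -/
theorem nonempty_contactGraph_iso_of_isArrangedIn {S : Set E3} {P : Finset E3}
    (h : IsArrangedIn S P) :
    Nonempty (contactGraph S ≃g contactGraph ((fun p => (2 : ℝ) • p) '' (P : Set E3))) := by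
  obtain ⟨A, rfl⟩ := h
  set R : Set E3 := (fun p => (2 : ℝ) • p) '' (P : Set E3) with hR
  have hSR : (fun p => (2 : ℝ) • A p) '' (P : Set E3) = A '' R := by
    rw [hR, Set.image_image]; simp only [map_smul]
  let e0 : R ≃ A '' R := Equiv.Set.image A R A.injective
  let e1 : ↥(A '' R) ≃ ↥((fun p => (2 : ℝ) • A p) '' (P : Set E3)) := Equiv.setCongr hSR.symm
  refine ⟨RelIso.symm ⟨e0.trans e1, ?_⟩⟩
  intro p q
  simp only [contactGraph_adj, Equiv.trans_apply]
  change dist (A p) (A q) = 2 ↔ dist (p : E3) q = 2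
  rw [A.dist_map]

/-- Hence the two named facts are equivalent given the elementary direction:
`Hales2012_kissingConfigCongruent → Hales2012_contactGraphFccOrHcp`. [folklore] -/
theorem contactGraphFccOrHcp_of_kissingConfigCongruent (h : Hales2012_kissingConfigCongruent) :
    Hales2012_contactGraphFccOrHcp := fun S hS =>
  (h S hS).imp nonempty_contactGraph_iso_of_isArrangedIn nonempty_contactGraph_iso_of_isArrangedIn

/-- The two computer-assisted named facts of `FejesTothKissingTwelve.lean` are equivalent.
[cite: Hales2012, Lemma 10] -/
theorem kissingConfigCongruent_iff_contactGraphFccOrHcp :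
    Hales2012_kissingConfigCongruent ↔ Hales2012_contactGraphFccOrHcp :=
  ⟨contactGraphFccOrHcp_of_kissingConfigCongruent, kissingConfigCongruent_of_contactGraphFccOrHcp⟩

/-- **Theorem 1 from Lemma 1 (`flyspeck_L12`) and Theorem 3 + Lemma 9 (graph form)** — the printed
reduction with Lemma 2 and Lemma 10 both proved: `flyspeck_L12 → Hales2012_contactGraphFccOrHcp →
Hales2012_kissingTwelve`. [cite: Hales2012, Theorem 1 (proof, pp. 2 and 14)] -/
theorem hales2012_kissingTwelve_of_L12_of_contactGraph (hL12 : flyspeck_L12)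
    (h9 : Hales2012_contactGraphFccOrHcp) : Hales2012_kissingTwelve :=
  hales2012_kissingTwelve_of_L12 hL12 (kissingConfigCongruent_of_contactGraphFccOrHcp h9)

/-- And Fejes Tóth's conjecture from `L12`, Theorem 3 + Lemma 9, and *Dense Sphere Packings* §1.3.
[cite: Hales2012, §1] -/
theorem fejesTothKissingTwelve_of_L12_of_contactGraph (hL12 : flyspeck_L12)
    (h9 : Hales2012_contactGraphFccOrHcp) (h2 : HalesDSP_layerPackings) : FejesTothKissingTwelve :=
  fejesTothKissingTwelve_of (hales2012_kissingTwelve_of_L12_of_contactGraph hL12 h9) h2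

end Literature.Geometry.DiscreteGeometry
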